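import Literature.NumberTheory.Sieve.FGKMT2018Section8Toolbox
import HarnessLib

/-!
# FGKMT 2018 §8 — the estimates (6.2)–(6.6) of Theorem 5 from Theorem 6

Fifth support file for the edge «Theorem 6 ⟹ Theorem 5» of Ford–Green–Konyagin–Maynard–Tao,
*Long gaps between primes* (§8, arXiv:1412.5029v4 pp. 22–24). With the data of Theorem 6
(`FordGreenKonyaginMaynardTao2018_theorem6ZN` — Theorem 6 ∘ Lemma 7.2 for admissible non-degenerate
families: the modulus `B`, the functions `F_k`, the integrals `I_k, J_k`, the constant `K`)
specialised to one tuple size `k = r` and the level `R = (x/4)^{1/9}` (`Section8Block`; the §8 families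
`𝓛_p`, `L̃_{q,i}` and their translates are non-degenerate: `formsNondegenerate_tupleForms`,
`formsNondegenerate_wbpForms`, `formsNondegenerate_shiftForms`), and in the regime of §8
(`Section8Hyp`: `x` large in terms of `K`, `K'`, the PNT constant `A`; `2 ≤ r ≤ log^{1/5} x`;
`H ⊂ [1, 2r²]` admissible of size `r`), we define the weight of Theorem 5,

  `w(p, n) = 1_{p ∈ 𝒫, n ∈ [−⌊y⌋, ⌊y⌋]} · w_{r, 𝓛_p, B, R}(n)`,   `𝓛_p = {n + h_i p}`  (`wFun`),

the quantities `τ = 2 (B/φ(B))^r 𝔖_B(𝓛_1) (log R)^r (log x)^r I_r` (`tauVal`) and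
`u = (φ(B)/B) (log R/log x) (r J_r/(2 I_r))` (`uVal`), and prove the five assertions of Theorem 5:
the bounds (6.2) on `τ`, `u` (`tau_ge`, `u_mem`), (6.3) (`est63`), (6.4) (`est64`), (6.5) (`est65`)
and the size bound (6.6) (`w_le`), each with an explicit constant `≤ kFive K A` in front of
`1/log₂^{10} x` times the main term. The assembly into
`FordGreenKonyaginMaynardTao2018_theorem6ZN → FordGreenKonyaginMaynardTao2018_theorem5_local` is the
next file (`FGKMT2018Theorem5OfTheorem6`).

## References
* K. Ford, B. Green, S. Konyagin, J. Maynard, T. Tao, *Long gaps between primes*, J. Amer. Math.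
  Soc. 31 (2018) 65–105, §8 (arXiv:1412.5029v4 pp. 22–24) [FordGreenKonyaginMaynardTao2018].
-/

open Finset Filter Topology

namespace Literature.NumberTheory.Sieve.FGKMT2018

/-! ### Non-degeneracy of the §8 families (erratum 2026-08-29 on Theorem 6's rendering) -/

/-- Translation preserves non-degeneracy. [cite: FordGreenKonyaginMaynardTao2018, §8 (translation steps)] -/
theorem formsNondegenerate_shiftForms {k : ℕ} (L : Fin k → ℤ × ℤ) (c : ℤ) :
    FormsNondegenerate (shiftForms L c) ↔ FormsNondegenerate L := by
  unfold FormsNondegenerate shiftForms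
  refine forall₂_congr fun i j => ?_
  refine imp_congr_right fun _ => not_congr ⟨fun h => ?_, fun h => ?_⟩
  · dsimp only at h
    linear_combination h
  · dsimp only
    linear_combination h

/-- `𝓛_p = {n + h_i p}` is non-degenerate for injective `h` and `p ≠ 0`.
[cite: FordGreenKonyaginMaynardTao2018, §8 p. 22 (the family 𝓛_p)] -/
theorem formsNondegenerate_tupleForms {k : ℕ} (h : Fin k → ℤ) (hinj : Function.Injective h)
    {p : ℕ} (hp : p ≠ 0) : FormsNondegenerate (tupleForms h p) := by
  intro i j hij
  simp only [tupleForms, one_mul]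
  intro e
  exact hij (hinj (mul_right_cancel₀ (by exact_mod_cast hp : (p : ℤ) ≠ 0) e)).symm

/-- `L̃_{q,i₀}` is non-degenerate for injective `h` and `q ≠ 0`.
[cite: FordGreenKonyaginMaynardTao2018, §8 proof of (6.4) (the family L̃_{q,i})] -/
theorem formsNondegenerate_wbpForms {k : ℕ} (h : Fin k → ℤ) (hinj : Function.Injective h)
    {q : ℕ} (hq : q ≠ 0) (i₀ : Fin k) : FormsNondegenerate (wbpForms h q i₀) := by
  have hq' : (q : ℤ) ≠ 0 := by exact_mod_cast hq
  intro i j hij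
  unfold wbpForms
  by_cases hi : i = i₀ <;> by_cases hj : j = i₀
  · exact absurd (hi.trans hj.symm) hij
  · simp only [hi, hj, if_true, if_false, one_mul, mul_zero]; exact hq'
  · simp only [hi, hj, if_true, if_false, one_mul, mul_zero]; exact fun e => hq' e.symm
  · simp only [hi, hj, if_false]
    intro e
    have e' : h i - h i₀ = h j - h i₀ := mul_right_cancel₀ hq' e
    exact hij (hinj (by linarith))

/-! ### Theorem 6 at one tuple size and the §8 level `R = (x/4)^{1/9}` -/

/-- **Theorem 6 specialised as in §8**: tuple size `k = r`, level `R = (x/4)^{1/9}`, modulus `B`,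
at the scale `x` — the conclusions (7.11)–(7.15) for every admissible NON-DEGENERATE family of `r`
forms with coefficients `|a| ≤ log x`, `|b| ≤ x log² x` and every `X ∈ [x/2, x log² x]` (the
non-degeneracy hypothesis `FormsNondegenerate` is the 2026-08-29 erratum on the rendering of Theorem 6:
the block is now derived from `FordGreenKonyaginMaynardTao2018_theorem6ZN`, see `section8Block_ofN`).
[cite: FordGreenKonyaginMaynardTao2018, §8 p. 22 («we apply Theorem 6 with R = (x/4)^{1/9}»)] -/
def Section8Block (K : ℝ) (r : ℕ) (F : (Fin r → ℝ) → ℝ) (I J ε : ℝ) (x B : ℕ) : Prop :=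
  ∀ (L : Fin r → ℤ × ℤ) (X : ℝ), FormsAdmissible L → FormsNondegenerate L →
    (∀ i, |(((L i).1 : ℤ) : ℝ)| ≤ Real.log x ∧ |(((L i).2 : ℤ) : ℝ)| ≤ x * Real.log x ^ 2) →
    (x : ℝ) / 2 ≤ X → X ≤ x * Real.log x ^ 2 →
    Real.exp (-(K * r)) ≤ singSeriesExcl L B ∧
    |∑ n ∈ dyadZ X, sieveWt L B (rLevel x) F n - mainTermA L B X (rLevel x) I|
        ≤ K / Real.log X ^ ((1 : ℝ) / 10) * mainTermA L B X (rLevel x) I ∧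
    (∀ i : Fin r, Nat.Coprime (L i).1.natAbs B →
      (∀ n ∈ dyadZ X, rLevel x < (formEval (L i) n : ℝ)) →
      |∑ n ∈ (dyadZ X).filter (fun n => 0 < formEval (L i) n ∧ (formEval (L i) n).natAbs.Prime),
            sieveWt L B (rLevel x) F n - mainTermB L B X (rLevel x) J i|
        ≤ K / Real.log X ^ ((1 : ℝ) / 10) * mainTermB L B X (rLevel x) J i
            + K * errTermB L B X (rLevel x) I) ∧
    (∀ l₀ : ℤ × ℤ, l₀.1 ≠ 0 → |((l₀.1 : ℤ) : ℝ)| ≤ X ^ 2 → |((l₀.2 : ℤ) : ℝ)| ≤ X ^ 2 →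
      (∀ j, l₀.1 * (L j).2 - (L j).1 * l₀.2 ≠ 0) →
      ∑ n ∈ (dyadZ X).filter (fun n => 0 < formEval l₀ n ∧ (formEval l₀ n).natAbs.Prime ∧
          X ^ ((1 : ℝ) / 30) < (formEval l₀ n : ℝ)), sieveWt L B (rLevel x) F n
        ≤ K * ((discDelta L l₀ : ℝ) / Nat.totient (discDelta L l₀)) * errTermB L B X (rLevel x) I) ∧
    (∀ n : ℤ, sieveWt L B (rLevel x) F n ≤ X ^ ((2 : ℝ) / 9 + ε))

/-- The block follows from the data of Theorem 6 at a scale `x` where `R = (x/4)^{1/9}` lies in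
the window `[X^{1/30}, X^{1/9}]` for all `X ∈ [x/2, x log² x]` (`rLevel_window`). LEGACY entry point
keyed to the superseded rendering `FordGreenKonyaginMaynardTao2018_theorem6Z` (no non-degeneracy
hypothesis); the live one is `section8Block_ofN`.
[cite: FordGreenKonyaginMaynardTao2018, §8 p. 22] -/
theorem section8Block_of {C : ℕ} {K : ℝ} {F : (k : ℕ) → (Fin k → ℝ) → ℝ} {I J : ℕ → ℝ}
    {ε : ℝ} {x B r : ℕ}
    (h6x : ∀ (k : ℕ) (L : Fin k → ℤ × ℤ) (X R : ℝ), C ≤ k → (k : ℝ) ≤ Real.log x ^ ((1 : ℝ) / 5) →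
        FormsAdmissible L →
        (∀ i, |(((L i).1 : ℤ) : ℝ)| ≤ Real.log x ∧ |(((L i).2 : ℤ) : ℝ)| ≤ x * Real.log x ^ 2) →
        (x : ℝ) / 2 ≤ X → X ≤ x * Real.log x ^ 2 →
        X ^ ((1 : ℝ) / 30) ≤ R → R ≤ X ^ ((1 : ℝ) / 9) →
        Real.exp (-(K * k)) ≤ singSeriesExcl L B ∧
        |∑ n ∈ dyadZ X, sieveWt L B R (F k) n - mainTermA L B X R (I k)|
            ≤ K / Real.log X ^ ((1 : ℝ) / 10) * mainTermA L B X R (I k) ∧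
        (∀ i : Fin k, Nat.Coprime (L i).1.natAbs B → (∀ n ∈ dyadZ X, R < (formEval (L i) n : ℝ)) →
          |∑ n ∈ (dyadZ X).filter (fun n => 0 < formEval (L i) n ∧ (formEval (L i) n).natAbs.Prime),
                sieveWt L B R (F k) n - mainTermB L B X R (J k) i|
            ≤ K / Real.log X ^ ((1 : ℝ) / 10) * mainTermB L B X R (J k) i
                + K * errTermB L B X R (I k)) ∧
        (∀ l₀ : ℤ × ℤ, l₀.1 ≠ 0 → |((l₀.1 : ℤ) : ℝ)| ≤ X ^ 2 → |((l₀.2 : ℤ) : ℝ)| ≤ X ^ 2 →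
          (∀ j, l₀.1 * (L j).2 - (L j).1 * l₀.2 ≠ 0) →
          ∑ n ∈ (dyadZ X).filter (fun n => 0 < formEval l₀ n ∧ (formEval l₀ n).natAbs.Prime ∧
              X ^ ((1 : ℝ) / 30) < (formEval l₀ n : ℝ)), sieveWt L B R (F k) n
            ≤ K * ((discDelta L l₀ : ℝ) / Nat.totient (discDelta L l₀)) * errTermB L B X R (I k)) ∧
        (∀ n : ℤ, sieveWt L B R (F k) n ≤ X ^ ((2 : ℝ) / 9 + ε)))
    (hCr : C ≤ r) (hr5 : (r : ℝ) ≤ Real.log x ^ ((1 : ℝ) / 5))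
    (hwin : ∀ X : ℝ, (x : ℝ) / 2 ≤ X → X ≤ (x : ℝ) * Real.log x ^ 2 →
      X ^ ((1 : ℝ) / 30) ≤ rLevel x ∧ rLevel x ≤ X ^ ((1 : ℝ) / 9) ∧ 1 ≤ X) :
    Section8Block K r (F r) (I r) (J r) ε x B := by
  intro L X hadm _ hcoef hX1 hX2
  obtain ⟨hR1, hR2, -⟩ := hwin X hX1 hX2
  exact h6x r L X (rLevel x) hCr hr5 hadm hcoef hX1 hX2 hR1 hR2

/-- The block from the data of the REPAIRED fact `FordGreenKonyaginMaynardTao2018_theorem6ZN` (Theorem 6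
for non-degenerate families) at a scale `x` where `R = (x/4)^{1/9}` lies in the window
`[X^{1/30}, X^{1/9}]` for all `X ∈ [x/2, x log² x]`.
[cite: FordGreenKonyaginMaynardTao2018, §8 p. 22] -/
theorem section8Block_ofN {C : ℕ} {K : ℝ} {F : (k : ℕ) → (Fin k → ℝ) → ℝ} {I J : ℕ → ℝ}
    {ε : ℝ} {x B r : ℕ}
    (h6x : ∀ (k : ℕ) (L : Fin k → ℤ × ℤ) (X R : ℝ), C ≤ k → (k : ℝ) ≤ Real.log x ^ ((1 : ℝ) / 5) →
        FormsAdmissible L → FormsNondegenerate L →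
        (∀ i, |(((L i).1 : ℤ) : ℝ)| ≤ Real.log x ∧ |(((L i).2 : ℤ) : ℝ)| ≤ x * Real.log x ^ 2) →
        (x : ℝ) / 2 ≤ X → X ≤ x * Real.log x ^ 2 →
        X ^ ((1 : ℝ) / 30) ≤ R → R ≤ X ^ ((1 : ℝ) / 9) →
        Real.exp (-(K * k)) ≤ singSeriesExcl L B ∧
        |∑ n ∈ dyadZ X, sieveWt L B R (F k) n - mainTermA L B X R (I k)|
            ≤ K / Real.log X ^ ((1 : ℝ) / 10) * mainTermA L B X R (I k) ∧
        (∀ i : Fin k, Nat.Coprime (L i).1.natAbs B → (∀ n ∈ dyadZ X, R < (formEval (L i) n : ℝ)) →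
          |∑ n ∈ (dyadZ X).filter (fun n => 0 < formEval (L i) n ∧ (formEval (L i) n).natAbs.Prime),
                sieveWt L B R (F k) n - mainTermB L B X R (J k) i|
            ≤ K / Real.log X ^ ((1 : ℝ) / 10) * mainTermB L B X R (J k) i
                + K * errTermB L B X R (I k)) ∧
        (∀ l₀ : ℤ × ℤ, l₀.1 ≠ 0 → |((l₀.1 : ℤ) : ℝ)| ≤ X ^ 2 → |((l₀.2 : ℤ) : ℝ)| ≤ X ^ 2 →
          (∀ j, l₀.1 * (L j).2 - (L j).1 * l₀.2 ≠ 0) →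
          ∑ n ∈ (dyadZ X).filter (fun n => 0 < formEval l₀ n ∧ (formEval l₀ n).natAbs.Prime ∧
              X ^ ((1 : ℝ) / 30) < (formEval l₀ n : ℝ)), sieveWt L B R (F k) n
            ≤ K * ((discDelta L l₀ : ℝ) / Nat.totient (discDelta L l₀)) * errTermB L B X R (I k)) ∧
        (∀ n : ℤ, sieveWt L B R (F k) n ≤ X ^ ((2 : ℝ) / 9 + ε)))
    (hCr : C ≤ r) (hr5 : (r : ℝ) ≤ Real.log x ^ ((1 : ℝ) / 5))
    (hwin : ∀ X : ℝ, (x : ℝ) / 2 ≤ X → X ≤ (x : ℝ) * Real.log x ^ 2 →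
      X ^ ((1 : ℝ) / 30) ≤ rLevel x ∧ rLevel x ≤ X ^ ((1 : ℝ) / 9) ∧ 1 ≤ X) :
    Section8Block K r (F r) (I r) (J r) ε x B := by
  intro L X hadm hnd hcoef hX1 hX2
  obtain ⟨hR1, hR2, -⟩ := hwin X hX1 hX2
  exact h6x r L X (rLevel x) hCr hr5 hadm hnd hcoef hX1 hX2 hR1 hR2

/-! ### The objects of Theorem 5 built from Theorem 6's data -/

/-- `𝔖 = 𝔖_B(𝓛_1)`, the singular series of §8 (the factors at `p ∣ B` excluded).
[cite: FordGreenKonyaginMaynardTao2018, §8 p. 22 («𝔖 := 𝔖(𝓛_1)»)] -/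
noncomputable def sigmaH {r : ℕ} (H : Finset ℤ) (hk : H.card = r) (B : ℕ) : ℝ :=
  singSeriesExcl (tupleForms (tupleEnum H hk) 1) B

/-- `τ := 2 (B/φ(B))^r 𝔖 (log R)^r (log x)^r I_r` — §8's `τ` (8.1), with `x` in place of `y` in the
outer logarithm (harmless: only `x^{-o(1)} ≤ τ` is required).
[cite: FordGreenKonyaginMaynardTao2018, (8.1) p. 22] -/
noncomputable def tauVal {r : ℕ} (H : Finset ℤ) (hk : H.card = r) (B x : ℕ) (I : ℝ) : ℝ :=
  2 * bOverPhi B ^ r * sigmaH H hk B * Real.log (rLevel x) ^ r * Real.log x ^ r * I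

/-- `u := (φ(B)/B) (log R/log x) (r J_r/(2 I_r))` — §8's `u` (8.2).
[cite: FordGreenKonyaginMaynardTao2018, (8.2) p. 22] -/
noncomputable def uVal (r B x : ℕ) (I J : ℝ) : ℝ :=
  (bOverPhi B)⁻¹ * (Real.log (rLevel x) / Real.log x) * ((r : ℝ) * J / (2 * I))

/-- The weight of Theorem 5: `w(p, n) = w_{r, 𝓛_p, B, R}(n)` for `p ∈ 𝒫` and `n ∈ [−⌊y⌋, ⌊y⌋]`,
and `0` otherwise. [cite: FordGreenKonyaginMaynardTao2018, §8 p. 22 («w(p, n) := w_{k,𝓛_p,B,R}(n) for p ∈ 𝒫, |n| ≤ y»)] -/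
noncomputable def wFun {r : ℕ} (c : ℝ) (x : ℕ) (H : Finset ℤ) (hk : H.card = r) (B : ℕ)
    (F : (Fin r → ℝ) → ℝ) : ℕ → ℤ → ℝ := fun p n =>
  if p ∈ primesHalf x ∧ n ∈ weightWindow c x then
    sieveWt (tupleForms (tupleEnum H hk) p) B (rLevel x) F n else 0

/-- The explicit constant of Theorem 5 in terms of Theorem 6's `K` and the PNT constant `A`.
[cite: FordGreenKonyaginMaynardTao2018, §8 (all implied constants depend on Theorem 6 only)] -/
def kFive (K A : ℝ) : ℝ := 1600 * K ^ 2 + 200 * K + 2 * A + 100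

/-! ### The regime of §8 -/

/-- **The hypotheses of §8 at one scale `x`**: Theorem 6's block for `k = r`; `B ∈ {1} ∪ primes`,
`B ≤ x`; `H ⊂ [1, 2r²]` admissible with `#H = r`, `2 ≤ r ≤ log^{1/5} x`; the size relations of
`I_r, J_r`; and the growth facts of `x` (in terms of `K`, `K'`, the PNT constant `A`), the prime
number theorem for `#𝒫`, Landau's bound for `n/φ(n)`, and `x^{-ε} ≤ 2e^{-Kk} K⁻¹ (2k log k)^{-k}`.
[cite: FordGreenKonyaginMaynardTao2018, §8 pp. 22–24] -/
structure Section8Hyp (K A : ℝ) (r : ℕ) (F : (Fin r → ℝ) → ℝ) (I J ε c K' : ℝ) (x B : ℕ)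
    (H : Finset ℤ) : Prop where
  hK : 0 < K
  hA : 0 ≤ A
  hK' : 0 < K'
  blk : Section8Block K r F I J ε x B
  hB : B = 1 ∨ B.Prime
  hBx : B ≤ x
  hH : IsAdmissibleTuple H
  card : H.card = r
  two_le : 2 ≤ r
  le_t2 : (r : ℝ) ≤ Real.log x ^ ((1 : ℝ) / 5)
  bounds : ∀ h ∈ H, 1 ≤ h ∧ h ≤ 2 * (#H : ℤ) ^ 2
  hI : 0 < I
  hIK : (2 * (r : ℝ) * Real.log r) ^ (-(r : ℝ)) ≤ K * I
  hJ1 : Real.log r / r * I ≤ K * J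
  hJ2 : J ≤ K * (Real.log r / r * I)
  hε : 0 < ε
  hc : 0 < c
  hc1 : c ≤ 1
  M_le : 3 * A + 2 * K + 1600 * K ^ 2 + K' + 10 ≤ Real.log (Real.log x)
  seven_le : 7 ≤ Real.log (Real.log x)
  l2_pow : Real.log (Real.log x) ^ 11 ≤ Real.log x ^ ((1 : ℝ) / 10)
  l2_le_t : Real.log (Real.log x) ≤ Real.log x ^ ((1 : ℝ) / 10)
  t_pow : (Real.log x ^ ((1 : ℝ) / 10)) ^ 10 = Real.log x
  L2_le_x : Real.log x ^ 2 ≤ x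
  y_le : ySieve c x ≤ x * Real.log x
  le_y : 2 * (Real.log x ^ ((1 : ℝ) / 10)) ^ 4 * x + x ≤ ySieve c x
  x32 : 32 ≤ x
  lR1 : 1 ≤ Real.log (rLevel x)
  lR_lo : 1 / 10 ≤ Real.log (rLevel x) / Real.log x
  lR_hi : Real.log (rLevel x) / Real.log x ≤ 1 / 9
  pnt : |(#(primesHalf x) : ℝ) - x / (2 * Real.log x)| ≤ A / Real.log x * (x / (2 * Real.log x))
  tot : ∀ n : ℕ, x ≤ 2 * n → (n : ℝ) / Nat.totient n ≤ 3 * Real.log (Real.log n)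
  tau_fact : ∀ k : ℕ, 2 ≤ k → (k : ℝ) ≤ Real.log x ^ ((1 : ℝ) / 5) →
    (x : ℝ) ^ (-ε) ≤ 2 * Real.exp (-(K * k)) * (K⁻¹ * (2 * (k : ℝ) * Real.log k) ^ (-(k : ℝ)))

namespace Section8Hyp

variable {K A : ℝ} {r : ℕ} {F : (Fin r → ℝ) → ℝ} {I J ε c K' : ℝ} {x B : ℕ} {H : Finset ℤ}

/-- Numerical consequences of the regime. [cite: FordGreenKonyaginMaynardTao2018, §8 («x sufficiently large»)] -/
theorem regime (S : Section8Hyp K A r F I J ε c K' x B H) :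
    (32 : ℝ) ≤ x ∧ 7 ≤ Real.log x ^ ((1 : ℝ) / 10) ∧
    Real.log x ^ ((1 : ℝ) / 10) ≤ Real.log x ∧ Real.log (Real.log x) ≤ Real.log x ∧
    (2 : ℝ) ≤ r ∧ (r : ℝ) ≤ (Real.log x ^ ((1 : ℝ) / 10)) ^ 2 ∧
    2 * (r : ℝ) ^ 2 ≤ Real.log x ∧ 4 * (r : ℝ) ^ 2 ≤ x ∧ 12 * (r : ℝ) ≤ x ∧
    0 < rLevel x ∧ rLevel x ≤ (x : ℝ) / 4 ∧
    (x : ℝ) ≤ ySieve c x ∧ ySieve c x < ⌊ySieve c x⌋₊ + 1 ∧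
    (⌊ySieve c x⌋₊ : ℝ) ≤ ySieve c x ∧ 2 * x ≤ ⌊ySieve c x⌋₊ := by
  have hx32 : (32 : ℝ) ≤ x := by exact_mod_cast S.x32
  set L := Real.log x with hL
  set t := L ^ ((1 : ℝ) / 10) with ht
  have ht7 : 7 ≤ t := S.seven_le.trans S.l2_le_t
  have ht1 : 1 ≤ t := by linarith
  have htL : t ≤ L := by
    calc t ≤ t ^ 10 := le_self_pow₀ ht1 (by norm_num)
      _ = L := S.t_pow
  have hL0 : 0 < L := by linarith
  have ht2 : t ^ 2 = L ^ ((1 : ℝ) / 5) := by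
    rw [ht, ← Real.rpow_natCast, ← Real.rpow_mul hL0.le]
    norm_num
  have hr2 : (2 : ℝ) ≤ r := by exact_mod_cast S.two_le
  have hrt : (r : ℝ) ≤ t ^ 2 := ht2 ▸ S.le_t2
  have hr4 : (r : ℝ) ^ 2 ≤ t ^ 4 := by
    have := pow_le_pow_left₀ (by linarith) hrt 2
    rw [← pow_mul] at this
    exact this
  have ht6 : (2 : ℝ) ≤ t ^ 6 := le_trans (by norm_num) (pow_le_pow_left₀ (by norm_num) ht7 6)
  have h2r2 : 2 * (r : ℝ) ^ 2 ≤ L := by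
    have h4 : 0 ≤ t ^ 4 := by positivity
    calc 2 * (r : ℝ) ^ 2 ≤ 2 * t ^ 4 := by linarith
      _ ≤ t ^ 6 * t ^ 4 := by nlinarith
      _ = t ^ 10 := by ring
      _ = L := S.t_pow
  have h4r4 : 4 * (r : ℝ) ^ 4 ≤ x := by
    have h1 : (2 * (r : ℝ) ^ 2) ^ 2 ≤ L ^ 2 := pow_le_pow_left₀ (by positivity) h2r2 2
    have h2 : 4 * (r : ℝ) ^ 4 = (2 * (r : ℝ) ^ 2) ^ 2 := by ring
    linarith [S.L2_le_x]
  have hr1sq : (1 : ℝ) ≤ (r : ℝ) ^ 2 := by nlinarith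
  have h4r2 : 4 * (r : ℝ) ^ 2 ≤ x := by
    have : 4 * (r : ℝ) ^ 2 * 1 ≤ 4 * (r : ℝ) ^ 2 * (r : ℝ) ^ 2 :=
      mul_le_mul_of_nonneg_left hr1sq (by positivity)
    nlinarith
  have h12r : 12 * (r : ℝ) ≤ x := by
    have hr3 : (8 : ℝ) ≤ (r : ℝ) ^ 3 := le_trans (by norm_num) (pow_le_pow_left₀ (by norm_num) hr2 3)
    have : 4 * (r : ℝ) * 8 ≤ 4 * (r : ℝ) * (r : ℝ) ^ 3 :=
      mul_le_mul_of_nonneg_left hr3 (by positivity)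
    nlinarith
  have hx0 : 0 < x := by have := S.x32; omega
  have hR4 : rLevel x ≤ (x : ℝ) / 4 := by
    have h1 : (1 : ℝ) ≤ x / 4 := by linarith
    calc rLevel x = ((x : ℝ) / 4) ^ ((1 : ℝ) / 9) := rfl
      _ ≤ ((x : ℝ) / 4) ^ (1 : ℝ) := Real.rpow_le_rpow_of_exponent_le h1 (by norm_num)
      _ = x / 4 := Real.rpow_one _
  have hxy : (x : ℝ) ≤ ySieve c x := by
    have : 0 ≤ 2 * t ^ 4 * (x : ℝ) := by positivity
    linarith [S.le_y]
  have hy0 : 0 ≤ ySieve c x := le_trans (by positivity) hxy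
  have h2xN : 2 * x ≤ ⌊ySieve c x⌋₊ := by
    apply Nat.le_floor
    push_cast
    have : (x : ℝ) ≤ 2 * t ^ 4 * x := by
      have : (1 : ℝ) ≤ 2 * t ^ 4 := by nlinarith [one_le_pow₀ (n := 4) ht1]
      nlinarith
    linarith [S.le_y]
  exact ⟨hx32, ht7, htL, S.l2_le_t.trans htL, hr2, hrt, h2r2, h4r2, h12r, rLevel_pos hx0, hR4, hxy,
    Nat.lt_floor_add_one _, Nat.floor_le hy0, h2xN⟩

/-- `1 ≤ h_i ≤ 2r²` along the enumeration. [cite: FordGreenKonyaginMaynardTao2018, Theorem 5] -/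
theorem hb (S : Section8Hyp K A r F I J ε c K' x B H) :
    ∀ i, 1 ≤ tupleEnum H S.card i ∧ tupleEnum H S.card i ≤ 2 * (r : ℤ) ^ 2 :=
  tupleEnum_bounds H S.card S.bounds

/-- `|h_i| ≤ 2r²` as reals. [cite: FordGreenKonyaginMaynardTao2018, Theorem 5] -/
theorem abs_h_le (S : Section8Hyp K A r F I J ε c K' x B H) (i : Fin r) :
    |((tupleEnum H S.card i : ℤ) : ℝ)| ≤ 2 * (r : ℝ) ^ 2 := by
  obtain ⟨h1, h2⟩ := S.hb i
  have h1' : (1 : ℝ) ≤ ((tupleEnum H S.card i : ℤ) : ℝ) := by exact_mod_cast h1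
  have h2' : ((tupleEnum H S.card i : ℤ) : ℝ) ≤ 2 * (r : ℝ) ^ 2 := by exact_mod_cast h2
  rw [abs_of_pos (by linarith)]
  exact h2'

/-- `ν_h(s) < s` for all primes. [cite: FordGreenKonyaginMaynardTao2018, §6] -/
theorem hadm (S : Section8Hyp K A r F I J ε c K' x B H) :
    ∀ s : ℕ, s.Prime → tupleCount (tupleEnum H S.card) s < s :=
  fun _ hs => tupleCount_lt_of_isAdmissibleTuple S.hH S.card hs

/-- Coefficient bounds for `𝓛_p` (`p ≤ x`) and its translates by `|c₀| ≤ (log x − 1) x log x`.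
[cite: FordGreenKonyaginMaynardTao2018, §8 («the coefficients are ≤ x log² x»)] -/
theorem coef_shift (S : Section8Hyp K A r F I J ε c K' x B H) {p : ℕ} (hpx : p ≤ x) {c₀ : ℤ}
    (hc₀ : |((c₀ : ℤ) : ℝ)| ≤ (Real.log x - 1) * (x * Real.log x)) :
    ∀ i, |(((shiftForms (tupleForms (tupleEnum H S.card) p) c₀ i).1 : ℤ) : ℝ)| ≤ Real.log x ∧
      |(((shiftForms (tupleForms (tupleEnum H S.card) p) c₀ i).2 : ℤ) : ℝ)| ≤ x * Real.log x ^ 2 := by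
  obtain ⟨hx32, ht7, htL, -, -, -, h2r2, -⟩ := S.regime
  intro i
  simp only [shiftForms, tupleForms]
  refine ⟨by rw [Int.cast_one, abs_one]; linarith, ?_⟩
  have hp' : (p : ℝ) ≤ x := by exact_mod_cast hpx
  have hh := S.abs_h_le i
  push_cast
  have h1 : |((tupleEnum H S.card i : ℤ) : ℝ) * p| ≤ Real.log x * x := by
    rw [abs_mul, Nat.abs_cast]
    exact mul_le_mul (hh.trans h2r2) hp' (Nat.cast_nonneg p) (by linarith)
  calc |((tupleEnum H S.card i : ℤ) : ℝ) * p - 1 * (c₀ : ℝ)|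
      ≤ |((tupleEnum H S.card i : ℤ) : ℝ) * p| + |1 * (c₀ : ℝ)| := abs_sub _ _
    _ ≤ Real.log x * x + (Real.log x - 1) * (x * Real.log x) := by
        rw [one_mul]; exact add_le_add h1 hc₀
    _ = x * Real.log x ^ 2 := by ring

/-- Coefficient bounds for `𝓛_p`, `p ≤ x`. [cite: FordGreenKonyaginMaynardTao2018, §8] -/
theorem coef_tupleForms (S : Section8Hyp K A r F I J ε c K' x B H) {p : ℕ} (hpx : p ≤ x) :
    ∀ i, |(((tupleForms (tupleEnum H S.card) p i).1 : ℤ) : ℝ)| ≤ Real.log x ∧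
      |(((tupleForms (tupleEnum H S.card) p i).2 : ℤ) : ℝ)| ≤ x * Real.log x ^ 2 := by
  have h := S.coef_shift hpx (c₀ := 0) (by
    obtain ⟨hx32, ht7, htL, -⟩ := S.regime
    rw [Int.cast_zero, abs_zero]
    have : (0 : ℝ) ≤ x * Real.log x := by positivity
    nlinarith)
  intro i
  have hi := h i
  simp only [shiftForms, mul_zero, sub_zero] at hi
  exact hi

/-! ### (6.6) and the support of `w` -/

/-- `w ≥ 0`. [cite: FordGreenKonyaginMaynardTao2018, Theorem 5 («w(p,n) ∈ ℝ⁺»)] -/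
theorem w_nonneg (S : Section8Hyp K A r F I J ε c K' x B H) (p : ℕ) (n : ℤ) :
    0 ≤ wFun c x H S.card B F p n := by
  unfold wFun
  split_ifs
  · exact sieveWt_nonneg _ _ _ _ _
  · exact le_rfl

/-- `w(p, n) ≠ 0 ⟹ p ∈ 𝒫 ∧ |n| ≤ y`. [cite: FordGreenKonyaginMaynardTao2018, Theorem 5 (support of w)] -/
theorem w_support (S : Section8Hyp K A r F I J ε c K' x B H) (p : ℕ) (n : ℤ)
    (h : wFun c x H S.card B F p n ≠ 0) : p ∈ primesHalf x ∧ |(n : ℝ)| ≤ ySieve c x := by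
  unfold wFun at h
  split_ifs at h with hcond
  · obtain ⟨-, -, -, -, -, -, -, -, -, -, -, hxy, -⟩ := S.regime
    exact ⟨hcond.1, abs_le_of_mem_weightWindow (le_trans (Nat.cast_nonneg _) hxy) hcond.2⟩
  · exact absurd rfl h

/-- **(6.6)** `w(p, n) ≤ x^{1/3 + ε}` (from (7.15) at `X = x/2`: `(x/2)^{2/9+ε} ≤ x^{1/3+ε}`).
[cite: FordGreenKonyaginMaynardTao2018, (6.6) from (7.15), §8 p. 24] -/
theorem w_le (S : Section8Hyp K A r F I J ε c K' x B H) (p : ℕ) (n : ℤ) :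
    wFun c x H S.card B F p n ≤ (x : ℝ) ^ (1 / 3 + ε : ℝ) := by
  unfold wFun
  split_ifs with hcond
  · obtain ⟨hx32, -, -, -, -, -, -, -⟩ := S.regime
    have hpx := le_of_mem_primesHalf hcond.1
    have hpr := (prime_of_mem_primesHalf hcond.1).1
    have hadm := formsAdmissible_tupleForms (tupleEnum H S.card) S.hadm (Or.inr hpr)
    have hX2 : (x : ℝ) / 2 ≤ x * Real.log x ^ 2 := by
      have : (1 : ℝ) ≤ Real.log x ^ 2 := by nlinarith [S.L2_le_x, S.regime.2.2.1, S.regime.2.1]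
      nlinarith
    obtain ⟨-, -, -, -, h5⟩ := S.blk _ ((x : ℝ) / 2) hadm
      (formsNondegenerate_tupleForms _ (tupleEnum_injective H S.card) hpr.ne_zero)
      (S.coef_tupleForms hpx) le_rfl hX2
    exact (h5 n).trans (rpow_half_le (by linarith) S.hε.le)
  · exact Real.rpow_nonneg (Nat.cast_nonneg _) _

/-! ### (6.2): the lower bound for `τ` and the window for `u` -/

/-- `𝔖 ≥ e^{-Kr}` ((7.11) for `𝓛_1`). [cite: FordGreenKonyaginMaynardTao2018, (7.11), §8 p. 22] -/
theorem sigmaH_ge (S : Section8Hyp K A r F I J ε c K' x B H) :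
    Real.exp (-(K * r)) ≤ sigmaH H S.card B := by
  obtain ⟨hx32, -⟩ := S.regime
  have hadm := formsAdmissible_tupleForms (tupleEnum H S.card) S.hadm (Or.inl rfl)
  have hX2 : (x : ℝ) / 2 ≤ x * Real.log x ^ 2 := by
    have : (1 : ℝ) ≤ Real.log x ^ 2 := by nlinarith [S.L2_le_x, S.regime.2.2.1, S.regime.2.1]
    nlinarith
  have h1x : 1 ≤ x := by have := S.x32; omega
  exact (S.blk _ ((x : ℝ) / 2) hadm
    (formsNondegenerate_tupleForms _ (tupleEnum_injective H S.card) one_ne_zero)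
    (S.coef_tupleForms h1x) le_rfl hX2).1

/-- `𝔖 > 0`. [cite: FordGreenKonyaginMaynardTao2018, §8] -/
theorem sigmaH_pos (S : Section8Hyp K A r F I J ε c K' x B H) : 0 < sigmaH H S.card B :=
  lt_of_lt_of_le (Real.exp_pos _) S.sigmaH_ge

/-- **(6.2), first half**: `x^{-ε} ≤ τ`. [cite: FordGreenKonyaginMaynardTao2018, (6.2)/(8.1) p. 22] -/
theorem tau_ge (S : Section8Hyp K A r F I J ε c K' x B H) :
    (x : ℝ) ^ (-ε) ≤ tauVal H S.card B x I := by
  have hL1 : 1 ≤ Real.log x := by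
    obtain ⟨-, ht7, htL, -⟩ := S.regime
    linarith
  calc (x : ℝ) ^ (-ε) ≤ 2 * Real.exp (-(K * r)) * (K⁻¹ * (2 * (r : ℝ) * Real.log r) ^ (-(r : ℝ))) :=
        S.tau_fact r S.two_le S.le_t2
    _ ≤ tauVal H S.card B x I :=
        tau_lower S.hK (one_le_bOverPhi S.hB) S.sigmaH_ge S.lR1 hL1 S.hIK

/-- `τ > 0`. [cite: FordGreenKonyaginMaynardTao2018, (8.1)] -/
theorem tau_pos (S : Section8Hyp K A r F I J ε c K' x B H) : 0 < tauVal H S.card B x I := by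
  have hx0 : (0 : ℝ) < x := by have := S.regime.1; linarith
  exact lt_of_lt_of_le (Real.rpow_pos_of_pos hx0 _) S.tau_ge

/-- **(6.2), second half**: `log r/(40K) ≤ u ≤ K log r` (so `u ≍ log r`).
[cite: FordGreenKonyaginMaynardTao2018, (6.2)/(8.2) p. 22] -/
theorem u_mem (S : Section8Hyp K A r F I J ε c K' x B H) :
    1 / (40 * K) * Real.log r ≤ uVal r B x I J ∧ uVal r B x I J ≤ max K (1 / (40 * K)) * Real.log r := by
  have hr1 : 1 ≤ r := le_trans (by norm_num) S.two_le
  have h := u_bounds S.hK hr1 S.hI S.hJ1 S.hJ2 (one_le_bOverPhi S.hB) (bOverPhi_le_two S.hB)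
    S.lR_lo (S.lR_hi.trans (by norm_num))
  have hlog : 0 ≤ Real.log r := Real.log_nonneg (by exact_mod_cast hr1)
  refine ⟨?_, h.2.trans (mul_le_mul_of_nonneg_right (le_max_left _ _) hlog)⟩
  rw [uVal]
  calc 1 / (40 * K) * Real.log r = Real.log r / (40 * K) := by ring
    _ ≤ _ := h.1

/-- Inverse-size facts of the regime (`ℓ = log₂ x`, `t = log^{1/10} x`).
[cite: FordGreenKonyaginMaynardTao2018, §8 («x sufficiently large»)] -/
theorem small (S : Section8Hyp K A r F I J ε c K' x B H) :
    0 < Real.log (Real.log x) ∧ 1 ≤ Real.log (Real.log x) ^ 10 ∧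
    7 * Real.log (Real.log x) ^ 10 ≤ Real.log x ^ ((1 : ℝ) / 10) ∧
    Real.log (Real.log x) ^ 10 ≤ Real.log x ^ ((1 : ℝ) / 10) ∧
    (Real.log x ^ ((1 : ℝ) / 10)) ^ 20 ≤ x ∧
    Real.log (Real.log x) * Real.log (Real.log x) ^ 10 ≤ Real.log x ∧
    (3 * A ≤ Real.log x ^ ((1 : ℝ) / 10) ∧ 2 * K + 10 ≤ Real.log x ^ ((1 : ℝ) / 10) ∧
      1600 * K ^ 2 ≤ Real.log x ^ ((1 : ℝ) / 10) ∧ K' + 2 ≤ Real.log x ^ ((1 : ℝ) / 10)) := by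
  obtain ⟨hx32, ht7, htL, -⟩ := S.regime
  have hA := S.hA
  have hK := S.hK
  have hK' := S.hK'
  have hK2 : 0 ≤ K ^ 2 := sq_nonneg K
  have hM := S.M_le.trans S.l2_le_t
  have hl7 := S.seven_le
  have hl10 : 1 ≤ Real.log (Real.log x) ^ 10 := one_le_pow₀ (by linarith)
  have h11 : Real.log (Real.log x) * Real.log (Real.log x) ^ 10 ≤ Real.log x ^ ((1 : ℝ) / 10) := by
    rw [← pow_succ']; exact S.l2_pow
  have h7 : 7 * Real.log (Real.log x) ^ 10 ≤ Real.log x ^ ((1 : ℝ) / 10) :=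
    le_trans (mul_le_mul_of_nonneg_right hl7 (by positivity)) h11
  have h20 : (Real.log x ^ ((1 : ℝ) / 10)) ^ 20 ≤ x := by
    rw [show (20 : ℕ) = 10 * 2 from rfl, pow_mul, S.t_pow]; exact S.L2_le_x
  exact ⟨by linarith, hl10, h7, by linarith, h20, h11.trans htL,
    ⟨by linarith, by linarith, by linarith, by linarith⟩⟩

/-- `B ≠ 0`. [cite: FordGreenKonyaginMaynardTao2018, Theorem 6] -/
theorem hB0 (S : Section8Hyp K A r F I J ε c K' x B H) : B ≠ 0 := by
  rcases S.hB with h1 | h1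
  · simp [h1]
  · exact h1.ne_zero

/-- For `p ∈ 𝒫`: `p` prime, `x/2 < p ≤ x`, `2r² < p`, `⌊R⌋ < p`.
[cite: FordGreenKonyaginMaynardTao2018, §8] -/
theorem primesHalf_facts (S : Section8Hyp K A r F I J ε c K' x B H) {p : ℕ} (hp : p ∈ primesHalf x) :
    p.Prime ∧ (x : ℝ) < 2 * p ∧ (p : ℝ) ≤ x ∧ 2 * r ^ 2 < p ∧ ⌊rLevel x⌋₊ < p := by
  obtain ⟨hx32, -, -, -, -, -, -, h4r2, -, hR0, hR4, -⟩ := S.regime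
  obtain ⟨hpr, h2p⟩ := prime_of_mem_primesHalf hp
  have hp' : (x : ℝ) < 2 * p := by exact_mod_cast h2p
  have hpx' : (p : ℝ) ≤ x := by exact_mod_cast le_of_mem_primesHalf hp
  have hkp : 2 * r ^ 2 < p := by
    have : (2 * r ^ 2 : ℝ) < p := by linarith
    exact_mod_cast this
  have hRp : ⌊rLevel x⌋₊ < p := by
    have : (⌊rLevel x⌋₊ : ℝ) < p := lt_of_le_of_lt (Nat.floor_le hR0.le) (by linarith)
    exact_mod_cast this
  exact ⟨hpr, hp', hpx', hkp, hRp⟩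

/-- The error factor `|m − 1|` in the proof of (6.3).
[cite: FordGreenKonyaginMaynardTao2018, §8 proof of (6.3)] -/
theorem m63_bound {ρ D y X s : ℝ} (hX : 32 ≤ X) (hs : 2 ≤ s) (h12 : 12 * s ≤ X) (hXy : X ≤ y)
    (hρ1 : 1 ≤ ρ) (hρ2 : ρ * X ≤ X + 4 * s) (hD1 : 2 * y - 3 ≤ D) (hD2 : D ≤ 2 * y + 1) :
    |ρ * D / (2 * y) - 1| ≤ 9 * s / X := by
  have hy : 0 < y := by linarith
  have hX0 : 0 < X := by linarith
  have e1 : ρ * D / (2 * y) - 1 = (ρ * D - 2 * y) / (2 * y) := by field_simp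
  rw [e1, abs_div, abs_of_pos (by positivity : (0 : ℝ) < 2 * y),
    div_le_div_iff₀ (by positivity) hX0]
  have e2 : |ρ * D - 2 * y| * X = |(ρ * D - 2 * y) * X| := by rw [abs_mul, abs_of_pos hX0]
  rw [e2]
  have hρX : 0 ≤ ρ * X := by nlinarith
  have h1 : ρ * X * D ≤ ρ * X * (2 * y + 1) := mul_le_mul_of_nonneg_left hD2 hρX
  have h2 : ρ * X * (2 * y - 3) ≤ ρ * X * D := mul_le_mul_of_nonneg_left hD1 hρX
  have h3 : ρ * X * (2 * y) ≤ (X + 4 * s) * (2 * y) := mul_le_mul_of_nonneg_right hρ2 (by linarith)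
  have h4 : 1 * X ≤ ρ * X := mul_le_mul_of_nonneg_right hρ1 hX0.le
  have h5 : 2 * y ≤ s * y := mul_le_mul_of_nonneg_right hs hy.le
  refine abs_le.mpr ⟨?_, ?_⟩
  · nlinarith
  · nlinarith

/-- The window sum of `w(p, ·)` is the dyadic sum over `(2N, 4N]` of the translate of `𝓛_p` by
`3N`, `N = ⌊y⌋`. [cite: FordGreenKonyaginMaynardTao2018, §8 proof of (6.3) («by translation»)] -/
theorem window_sum_eq (S : Section8Hyp K A r F I J ε c K' x B H) {p : ℕ} (hp : p ∈ primesHalf x)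
    {N : ℕ} (hN : ⌊ySieve c x⌋₊ = N) :
    ∑ n ∈ weightWindow c x, wFun c x H S.card B F p n
      = ∑ m ∈ dyadZ (2 * (N : ℝ)),
          sieveWt (shiftForms (tupleForms (tupleEnum H S.card) p) (3 * (N : ℤ))) B
            (rLevel x) F m := by
  have h1 : ∑ n ∈ weightWindow c x, wFun c x H S.card B F p n
      = ∑ n ∈ weightWindow c x, sieveWt (tupleForms (tupleEnum H S.card) p) B (rLevel x) F n :=
    Finset.sum_congr rfl fun n hn => by unfold wFun; exact if_pos ⟨hp, hn⟩
  rw [h1, dyadZ_two_mul_natCast, weightWindow, hN]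
  have h2 := sum_Icc_sieveWt_eq_sum_shift (tupleForms (tupleEnum H S.card) p) B (rLevel x) F
    (-(N : ℤ)) (N : ℤ) (3 * (N : ℤ))
  rw [show -(N : ℤ) + 3 * (N : ℤ) = 2 * (N : ℤ) by ring,
    show (N : ℤ) + 3 * (N : ℤ) = 4 * (N : ℤ) by ring] at h2
  exact h2

set_option maxHeartbeats 1000000 in
/-- **(6.3)**: for `p ∈ 𝒫`, `∑_{|n| ≤ y} w(p, n) = (1 + O(1/log₂^{10} x)) τ y/log^r x`, from (7.12)
for the translate of `𝓛_p` on `(2⌊y⌋, 4⌊y⌋]` and `𝔖_B(𝓛_p) = (1 + O(r/p)) 𝔖`.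
[cite: FordGreenKonyaginMaynardTao2018, (6.3), §8 pp. 22–23] -/
theorem est63 (S : Section8Hyp K A r F I J ε c K' x B H) {p : ℕ} (hp : p ∈ primesHalf x) :
    |∑ n ∈ weightWindow c x, wFun c x H S.card B F p n
        - tauVal H S.card B x I * ySieve c x / Real.log x ^ r|
      ≤ kFive K A / Real.log (Real.log x) ^ 10
          * (tauVal H S.card B x I * ySieve c x / Real.log x ^ r) := by
  obtain ⟨N, hN⟩ : ∃ N : ℕ, ⌊ySieve c x⌋₊ = N := ⟨_, rfl⟩
  obtain ⟨hx32, ht7, htL, hl2L, hr2, hrt, h2r2, h4r2, h12r, hR0, hR4, hxy, hyN1, hNy, h2xN⟩ :=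
    S.regime
  rw [hN] at hyN1 hNy h2xN
  obtain ⟨hl0, hl10, h7l10, hl10t, ht20, hl11L, htA, htK, htK2, htK'⟩ := S.small
  obtain ⟨hpr, hp', hpx', hkp, hRp⟩ := S.primesHalf_facts hp
  have hK := S.hK
  have hpx := le_of_mem_primesHalf hp
  have hr1 : 1 ≤ r := le_trans (by norm_num) S.two_le
  have hx0 : (0 : ℝ) < x := by linarith
  have hL0 : 0 < Real.log x := by linarith
  have hy0 : 0 < ySieve c x := by linarith
  have ht1 : 1 ≤ Real.log x ^ ((1 : ℝ) / 10) := by linarith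
  have hN2x : 2 * (x : ℝ) ≤ N := by exact_mod_cast h2xN
  have hτ0 := S.tau_pos
  have hT0 : 0 ≤ tauVal H S.card B x I * ySieve c x / Real.log x ^ r := by positivity
  -- numerics
  have hNxL : (N : ℝ) ≤ x * Real.log x := hNy.trans S.y_le
  have hxL0 : (0 : ℝ) ≤ x * Real.log x := by positivity
  have hc0 : |((3 * (N : ℤ) : ℤ) : ℝ)| ≤ (Real.log x - 1) * (x * Real.log x) := by
    push_cast
    rw [abs_of_nonneg (by positivity)]
    nlinarith
  have hX1 : (x : ℝ) / 2 ≤ 2 * (N : ℝ) := by linarith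
  have hX2 : 2 * (N : ℝ) ≤ x * Real.log x ^ 2 := by nlinarith
  obtain ⟨ρ, hρ1, hρ2, hρ⟩ :=
    singSeriesExcl_tupleForms_ratio S.hH S.card hr1 S.hb hpr hkp S.hB0
  have hρx : ρ * x ≤ x + 4 * r := by
    have hp0 : (0 : ℝ) < p := by exact_mod_cast hpr.pos
    have h1 : ρ * x ≤ (1 + 2 * (r : ℝ) / p) * x := mul_le_mul_of_nonneg_right hρ2 hx0.le
    have h2 : 2 * (r : ℝ) / p * x ≤ 4 * r := by
      rw [div_mul_eq_mul_div, div_le_iff₀ hp0]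
      have := mul_le_mul_of_nonneg_left hp'.le (by positivity : (0 : ℝ) ≤ 2 * r)
      linarith
    have h3 : (1 + 2 * (r : ℝ) / p) * x = x + 2 * (r : ℝ) / p * x := by ring
    linarith
  have hd1 : 9 * (r : ℝ) / x ≤ 1 := by rw [div_le_one hx0]; linarith
  have ha0 : 0 ≤ K / Real.log (2 * (N : ℝ)) ^ ((1 : ℝ) / 10) := by
    have : 0 ≤ Real.log (2 * (N : ℝ)) := Real.log_nonneg (by linarith)
    positivity
  have hconst : 2 * (K / Real.log (2 * (N : ℝ)) ^ ((1 : ℝ) / 10)) + 9 * r / x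
      ≤ kFive K A / Real.log (Real.log x) ^ 10 := by
    have ha : K / Real.log (2 * (N : ℝ)) ^ ((1 : ℝ) / 10)
        ≤ K * (2 / Real.log x ^ ((1 : ℝ) / 10)) := by
      rw [div_eq_mul_one_div]
      exact mul_le_mul_of_nonneg_left (inv_log_rpow_le hx0 (by linarith) hX1) hK.le
    have h1 : K * (2 / Real.log x ^ ((1 : ℝ) / 10)) * 2 ≤ K / Real.log (Real.log x) ^ 10 := by
      rw [mul_div_assoc', div_mul_eq_mul_div, div_le_div_iff₀ (by linarith) (by linarith)]
      have e1 := mul_le_mul_of_nonneg_left h7l10 hK.le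
      have e2 := mul_nonneg hK.le (le_trans zero_le_one hl10)
      linarith only [e1, e2]
    have h2 : 9 * (r : ℝ) / x ≤ 9 / Real.log (Real.log x) ^ 10 := by
      rw [div_le_div_iff₀ hx0 (by linarith)]
      have h3 : (r : ℝ) * Real.log (Real.log x) ^ 10
          ≤ (Real.log x ^ ((1 : ℝ) / 10)) ^ 2 * Real.log x ^ ((1 : ℝ) / 10) :=
        mul_le_mul hrt hl10t (by positivity) (by positivity)
      have h4 : (Real.log x ^ ((1 : ℝ) / 10)) ^ 3 ≤ (Real.log x ^ ((1 : ℝ) / 10)) ^ 20 :=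
        pow_le_pow_right₀ ht1 (by norm_num)
      have e3 : (Real.log x ^ ((1 : ℝ) / 10)) ^ 2 * Real.log x ^ ((1 : ℝ) / 10)
          = (Real.log x ^ ((1 : ℝ) / 10)) ^ 3 := by ring
      linarith only [h3, h4, ht20, e3]
    have h5 : K / Real.log (Real.log x) ^ 10 + 9 / Real.log (Real.log x) ^ 10
        ≤ kFive K A / Real.log (Real.log x) ^ 10 := by
      rw [← add_div]
      apply div_le_div_of_nonneg_right _ (by positivity)
      rw [kFive]; nlinarith only [sq_nonneg K, S.hA, hK]
    have ha2 : 2 * (K / Real.log (2 * (N : ℝ)) ^ ((1 : ℝ) / 10))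
        ≤ K * (2 / Real.log x ^ ((1 : ℝ) / 10)) * 2 := by
      rw [mul_comm (K * _) 2]; exact mul_le_mul_of_nonneg_left ha zero_le_two
    exact (add_le_add (ha2.trans h1) h2).trans h5
  have hD3 : 2 * ySieve c x - 3 ≤ 2 * (N : ℝ) - 1 := by linarith
  have hD4 : 2 * (N : ℝ) + 1 ≤ 2 * ySieve c x + 1 := by linarith
  obtain ⟨hD1, hD2⟩ := card_dyadZ_bounds (X := 2 * (N : ℝ)) (by positivity)
  have hm : |ρ * #(dyadZ (2 * (N : ℝ))) / (2 * ySieve c x) - 1| ≤ 9 * r / x :=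
    m63_bound hx32 hr2 h12r hxy hρ1 hρx (hD3.trans hD1) (hD2.trans hD4)
  -- (7.12) for the translated family at `X = 2N`
  have hadm' : FormsAdmissible
      (shiftForms (tupleForms (tupleEnum H S.card) p) (3 * (N : ℤ))) :=
    (formsAdmissible_shiftForms _ _).mpr (formsAdmissible_tupleForms _ S.hadm (Or.inr hpr))
  obtain ⟨-, hA2, -, -, -⟩ :=
    S.blk _ (2 * (N : ℝ)) hadm'
      ((formsNondegenerate_shiftForms _ _).mpr
        (formsNondegenerate_tupleForms _ (tupleEnum_injective H S.card) hpr.ne_zero))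
      (S.coef_shift hpx hc0) hX1 hX2
  -- the main term is `m · T`
  have h𝔖' : singSeriesExcl (shiftForms (tupleForms (tupleEnum H S.card) p) (3 * (N : ℤ))) B
        = ρ * sigmaH H S.card B := by
    rw [singSeriesExcl_shiftForms, hρ, sigmaH]
  have hM : mainTermA (shiftForms (tupleForms (tupleEnum H S.card) p) (3 * (N : ℤ)))
        B (2 * (N : ℝ)) (rLevel x) I
      = ρ * #(dyadZ (2 * (N : ℝ))) / (2 * ySieve c x)
          * (tauVal H S.card B x I * ySieve c x / Real.log x ^ r) := by
    rw [mainTermA, h𝔖', tauVal]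
    field_simp
  -- conclude
  rw [S.window_sum_eq hp hN]
  exact (abs_sub_le_chain₂ hT0 hM hm hd1 hA2 ha0).trans (mul_le_mul_of_nonneg_right hconst hT0)

/-! ### (6.4) -/

/-- For `q ∈ 𝒬`: `q` prime, `x < q ≤ y`, `q ≤ ⌊y⌋`, `2r² < q`, `⌊R⌋ < q`, `q ∤ B`.
[cite: FordGreenKonyaginMaynardTao2018, §8 proof of (6.4)] -/
theorem primesQ_facts (S : Section8Hyp K A r F I J ε c K' x B H) {q : ℕ} (hq : q ∈ primesQ c x) :
    q.Prime ∧ (x : ℝ) < q ∧ (q : ℝ) ≤ ySieve c x ∧ q ≤ ⌊ySieve c x⌋₊ ∧ 2 * r ^ 2 < q ∧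
    ⌊rLevel x⌋₊ < q ∧ ¬ q ∣ B := by
  obtain ⟨hqr, hxq, hqy⟩ := bounds_of_mem_primesQ hq
  have hqN : q ≤ ⌊ySieve c x⌋₊ := by
    unfold primesQ at hq
    rw [Finset.mem_filter, Finset.mem_Icc] at hq
    exact hq.1.2
  obtain ⟨hx32, -, -, -, -, -, -, h4r2, -, hR0, hR4, -⟩ := S.regime
  have hxq' : (x : ℝ) < q := by exact_mod_cast hxq
  have hkq : 2 * r ^ 2 < q := by
    have : (2 * r ^ 2 : ℝ) < q := by linarith
    exact_mod_cast this
  have hRq : ⌊rLevel x⌋₊ < q := by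
    have : (⌊rLevel x⌋₊ : ℝ) < q := lt_of_le_of_lt (Nat.floor_le hR0.le) (by linarith)
    exact_mod_cast this
  have hqB : ¬ q ∣ B := fun h => by
    have h1 := Nat.le_of_dvd (Nat.pos_of_ne_zero S.hB0) h
    have h2 := S.hBx
    omega
  exact ⟨hqr, hxq', hqy, hqN, hkq, hRq, hqB⟩

/-- `q − h_i p ∈ [−⌊y⌋, ⌊y⌋]` for `q ∈ 𝒬`, `p ∈ 𝒫` (as `h_i p ≤ 2r² x ≤ ⌊y⌋`).
[cite: FordGreenKonyaginMaynardTao2018, §8 proof of (6.4) («|q − h_i p| ≤ y»)] -/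
theorem sub_mem_window (S : Section8Hyp K A r F I J ε c K' x B H) {q : ℕ} (hq : q ∈ primesQ c x)
    {p : ℕ} (hp : p ∈ primesHalf x) (i : Fin r) :
    (q : ℤ) - tupleEnum H S.card i * p ∈ weightWindow c x := by
  obtain ⟨N, hN⟩ : ∃ N : ℕ, ⌊ySieve c x⌋₊ = N := ⟨_, rfl⟩
  have hqN : q ≤ N := hN ▸ (S.primesQ_facts hq).2.2.2.1
  unfold weightWindow
  rw [hN, Finset.mem_Icc]
  obtain ⟨h1, h2⟩ := S.hb i
  have hpx : p ≤ x := le_of_mem_primesHalf hp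
  have key : 2 * (r : ℤ) ^ 2 * x ≤ N := by
    obtain ⟨hx32, ht7, htL, -, hr2, hrt, -, -, -, -, -, -, hyN1, -, -⟩ := S.regime
    rw [hN] at hyN1
    have hr4 : (r : ℝ) ^ 2 ≤ (Real.log x ^ ((1 : ℝ) / 10)) ^ 4 := by
      have := pow_le_pow_left₀ (by positivity) hrt 2
      rw [← pow_mul] at this
      exact this
    have h0 : (0 : ℝ) ≤ x := by positivity
    have h3 := mul_le_mul_of_nonneg_right hr4 h0
    have : 2 * (r : ℝ) ^ 2 * x ≤ N := by linarith [S.le_y]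
    exact_mod_cast this
  have hp0 : (0 : ℤ) ≤ p := by positivity
  have hpx' : (p : ℤ) ≤ x := by exact_mod_cast hpx
  have hq0 : (0 : ℤ) ≤ q := by positivity
  have hqN' : (q : ℤ) ≤ N := by exact_mod_cast hqN
  have hup : tupleEnum H S.card i * p ≤ 2 * (r : ℤ) ^ 2 * x :=
    (mul_le_mul_of_nonneg_right h2 hp0).trans (mul_le_mul_of_nonneg_left hpx' (by positivity))
  have hlo : (0 : ℤ) ≤ tupleEnum H S.card i * p := mul_nonneg (by linarith) hp0
  constructor <;> linarith

/-- `|ρ(1 + θ) − 1| ≤ 2η + δ` for `1 ≤ ρ ≤ 1 + η`, `|θ| ≤ δ ≤ 1`.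
[cite: FordGreenKonyaginMaynardTao2018, §8 proof of (6.4) (product of `1 + O(·)` factors)] -/
theorem m64_bound {ρ θ η δ : ℝ} (hρ1 : 1 ≤ ρ) (hρ2 : ρ ≤ 1 + η) (hθ : |θ| ≤ δ) (hδ1 : δ ≤ 1) :
    |ρ * (1 + θ) - 1| ≤ 2 * η + δ := by
  have hθ' := abs_le.mp hθ
  have e : ρ * (1 + θ) - 1 = (ρ - 1) * (1 + θ) + θ := by ring
  rw [e]
  refine (abs_add_le _ _).trans (add_le_add ?_ hθ)
  rw [abs_mul, abs_of_nonneg (by linarith : (0 : ℝ) ≤ ρ - 1)]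
  have h2 : |1 + θ| ≤ 2 := abs_le.mpr ⟨by linarith, by linarith⟩
  calc (ρ - 1) * |1 + θ| ≤ η * 2 := mul_le_mul (by linarith) h2 (abs_nonneg _) (by linarith)
    _ = 2 * η := by ring

/-- The prime number theorem for `#𝒫` in ratio form: `|#𝒫 · 2 log x/x − 1| ≤ A/log x`.
[cite: FordGreenKonyaginMaynardTao2018, §8 proof of (6.4) («by the prime number theorem»)] -/
theorem pnt_ratio (S : Section8Hyp K A r F I J ε c K' x B H) :
    |(#(primesHalf x) : ℝ) * (2 * Real.log x) / x - 1| ≤ A / Real.log x := by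
  obtain ⟨hx32, ht7, htL, -⟩ := S.regime
  have hx0 : (0 : ℝ) < x := by linarith
  have hL0 : 0 < Real.log x := by linarith
  have hc : 0 < (x : ℝ) / (2 * Real.log x) := by positivity
  have e : (#(primesHalf x) : ℝ) * (2 * Real.log x) / x - 1
      = ((#(primesHalf x) : ℝ) - x / (2 * Real.log x)) / (x / (2 * Real.log x)) := by
    field_simp
  rw [e, abs_div, abs_of_pos hc, div_le_iff₀ hc]
  exact S.pnt

/-- `L̃_q` (`wbpForms h q i₀`) is admissible with coefficients `≤ log x`, `≤ x log² x`, its `i₀`-th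
linear coefficient is `1`, and `R < n` on `(x/2, x]`.
[cite: FordGreenKonyaginMaynardTao2018, §8 proof of (6.4) (Theorem 6 applies to `L̃_q`)] -/
theorem wbpForms_facts (S : Section8Hyp K A r F I J ε c K' x B H) {q : ℕ} (hq : q ∈ primesQ c x)
    (i₀ : Fin r) :
    FormsAdmissible (wbpForms (tupleEnum H S.card) q i₀) ∧
    FormsNondegenerate (wbpForms (tupleEnum H S.card) q i₀) ∧
    (∀ j, |(((wbpForms (tupleEnum H S.card) q i₀ j).1 : ℤ) : ℝ)| ≤ Real.log x ∧
      |(((wbpForms (tupleEnum H S.card) q i₀ j).2 : ℤ) : ℝ)| ≤ x * Real.log x ^ 2) ∧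
    Nat.Coprime (wbpForms (tupleEnum H S.card) q i₀ i₀).1.natAbs B ∧
    (∀ n ∈ dyadZ ((x : ℝ) / 2 + 1 / 4),
      rLevel x < (formEval (wbpForms (tupleEnum H S.card) q i₀ i₀) n : ℝ)) := by
  obtain ⟨hx32, ht7, htL, hl2L, hr2, hrt, h2r2, h4r2, h12r, hR0, hR4, hxy, -, -, -⟩ := S.regime
  obtain ⟨hqr, hxq, hqy, hqN, hkq, hRq, hqB⟩ := S.primesQ_facts hq
  have hinc := tuple_incongruent_of_bounds _ (tupleEnum_injective H S.card) S.hb q hqr hkq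
  refine ⟨formsAdmissible_wbpForms _ (tupleEnum_injective H S.card) S.hadm hqr i₀
    (fun j hj => hinc j i₀ hj),
    formsNondegenerate_wbpForms _ (tupleEnum_injective H S.card) hqr.ne_zero i₀,
    fun j => ?_, ?_, fun n hn => ?_⟩
  · rw [wbpForms_fst, wbpForms_snd]
    have hxL : (0 : ℝ) ≤ x * Real.log x ^ 2 := by positivity
    split_ifs with hj
    · simp only [Int.cast_one, abs_one, Int.cast_zero, abs_zero]
      exact ⟨by linarith, hxL⟩
    · obtain ⟨a1, a2⟩ := S.hb j
      obtain ⟨b1, b2⟩ := S.hb i₀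
      have a1' : (1 : ℝ) ≤ ((tupleEnum H S.card j : ℤ) : ℝ) := by exact_mod_cast a1
      have a2' : ((tupleEnum H S.card j : ℤ) : ℝ) ≤ 2 * (r : ℝ) ^ 2 := by exact_mod_cast a2
      have b1' : (1 : ℝ) ≤ ((tupleEnum H S.card i₀ : ℤ) : ℝ) := by exact_mod_cast b1
      have b2' : ((tupleEnum H S.card i₀ : ℤ) : ℝ) ≤ 2 * (r : ℝ) ^ 2 := by exact_mod_cast b2
      refine ⟨?_, ?_⟩
      · push_cast
        rw [abs_le]
        constructor <;> linarith
      · push_cast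
        rw [Nat.abs_cast]
        have hL1 : (1 : ℝ) ≤ Real.log x := by linarith
        calc (q : ℝ) ≤ x * Real.log x := hqy.trans S.y_le
          _ ≤ x * Real.log x ^ 2 := by
            rw [sq, ← mul_assoc]
            exact le_mul_of_one_le_right (by positivity) hL1
  · rw [wbpForms_fst, if_pos rfl]
    simp
  · rw [formEval_wbpForms_self]
    have := (mem_dyadZ.mp hn).1
    linarith

set_option maxHeartbeats 1000000 in
/-- **(6.4), comparison step**: for `q ∈ 𝒬`, `p ∈ 𝒫`,
`w(p, q − h_{i₀} p) = λ_p · w_{L̃_q}(p)` with `|λ_p − 1| ≤ 12 r/x`, whence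
`|∑_p w(p, q − h_{i₀} p) − ∑_p w_{L̃_q}(p)| ≤ (12r/x) ∑_p w_{L̃_q}(p)`.
[cite: FordGreenKonyaginMaynardTao2018, §8 p. 23 («w(p, q − h_i p) = (1 + O(k/p)) w_{L̃}(p)»)] -/
theorem est64_compare (S : Section8Hyp K A r F I J ε c K' x B H) {q : ℕ} (hq : q ∈ primesQ c x)
    (i₀ : Fin r) :
    |∑ p ∈ primesHalf x, wFun c x H S.card B F p ((q : ℤ) - tupleEnum H S.card i₀ * p)
        - ∑ p ∈ primesHalf x, sieveWt (wbpForms (tupleEnum H S.card) q i₀) B (rLevel x) F p|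
      ≤ 12 * r / x
          * ∑ p ∈ primesHalf x, sieveWt (wbpForms (tupleEnum H S.card) q i₀) B (rLevel x) F p := by
  obtain ⟨hx32, ht7, htL, hl2L, hr2, hrt, h2r2, h4r2, h12r, hR0, hR4, hxy, -, -, -⟩ := S.regime
  obtain ⟨hqr, hxq, hqy, hqN, hkq, hRq, hqB⟩ := S.primesQ_facts hq
  have hr1 : 1 ≤ r := le_trans (by norm_num) S.two_le
  have hx0 : (0 : ℝ) < x := by linarith
  have hq0 : (0 : ℝ) < q := by exact_mod_cast hqr.pos
  have hWB : wCut r B * B ≠ 0 := Nat.mul_ne_zero (wCut_pos r B).ne' S.hB0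
  have hqWB : ¬ q ∣ wCut r B * B := not_dvd_wCut_mul hqr hkq hqB
  obtain ⟨ρq, hρq1, hρq2, hρq⟩ :=
    singSeriesExcl_wbpForms_ratio S.hH S.card hr1 S.hb hqr hkq hqWB hWB i₀
  have h𝔖1 := singSeriesExcl_tupleForms_one_pos S.hH S.card hWB
  have hη1 : 4 * (r : ℝ) / x ≤ 1 := by rw [div_le_one hx0]; linarith
  have hρq2' : ρq ≤ 1 + 4 * r / x := hρq2.trans (by
    have : 2 * (r : ℝ) / q ≤ 4 * r / x := by
      rw [div_le_div_iff₀ hq0 hx0]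
      have h1 := mul_le_mul_of_nonneg_left hxq.le (by positivity : (0 : ℝ) ≤ 2 * r)
      have h2 := mul_nonneg (by positivity : (0 : ℝ) ≤ 2 * r) hq0.le
      linarith
    linarith)
  have hrw : ∑ p ∈ primesHalf x, wFun c x H S.card B F p ((q : ℤ) - tupleEnum H S.card i₀ * p)
      = ∑ p ∈ primesHalf x,
          (singSeriesExcl (tupleForms (tupleEnum H S.card) p) (wCut r B * B) /
              singSeriesExcl (wbpForms (tupleEnum H S.card) q i₀) (wCut r B * B)) ^ 2 *
            sieveWt (wbpForms (tupleEnum H S.card) q i₀) B (rLevel x) F p := by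
    refine Finset.sum_congr rfl fun p hp => ?_
    obtain ⟨hpr, hp', hpx', hkp, hRp⟩ := S.primesHalf_facts hp
    have hw : wFun c x H S.card B F p ((q : ℤ) - tupleEnum H S.card i₀ * p)
        = sieveWt (tupleForms (tupleEnum H S.card) p) B (rLevel x) F
            ((q : ℤ) - tupleEnum H S.card i₀ * p) := by
      unfold wFun
      exact if_pos ⟨hp, S.sub_mem_window hq hp i₀⟩
    rw [hw]
    exact sieveWt_tupleForms_eq_sq_mul S.hH S.card hr1 S.hb F S.hB0 hpr hqr hkp hkq hRp hRq hqB i₀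
  rw [hrw]
  refine abs_sum_mul_sub_sum_le _ (fun p _ => sieveWt_nonneg _ _ _ _ _) fun p hp => ?_
  obtain ⟨hpr, hp', hpx', hkp, hRp⟩ := S.primesHalf_facts hp
  obtain ⟨ρp, hρp1, hρp2, hρp⟩ :=
    singSeriesExcl_tupleForms_ratio S.hH S.card hr1 S.hb hpr hkp hWB
  rw [hρp, hρq, mul_div_mul_right _ _ h𝔖1.ne']
  have hp0 : (0 : ℝ) < p := by exact_mod_cast hpr.pos
  have hρp2' : ρp ≤ 1 + 4 * r / x := hρp2.trans (by
    have : 2 * (r : ℝ) / p ≤ 4 * r / x := by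
      rw [div_le_div_iff₀ hp0 hx0]
      have := mul_le_mul_of_nonneg_left hp'.le (by positivity : (0 : ℝ) ≤ 2 * r)
      linarith
    linarith)
  calc |(ρp / ρq) ^ 2 - 1| ≤ 3 * (4 * (r : ℝ) / x) := abs_div_sq_sub_one_le hρp1 hρp2' hρq1 hρq2' hη1
    _ = 12 * (r : ℝ) / x := by ring

set_option maxHeartbeats 2000000 in
/-- **(6.4)**: for `q ∈ 𝒬` and `h ∈ H`,
`∑_{p ∈ 𝒫} w(p, q − hp) = (1 + O(1/log₂^{10} x)) τ (u/r) x/(2 log^r x)`, from (7.13) for `L̃_q` on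
`(x/2, x]`, the prime number theorem for `#𝒫`, and `𝔖_B(L̃_q) = (1 + O(r/q)) 𝔖`.
[cite: FordGreenKonyaginMaynardTao2018, (6.4), §8 p. 23] -/
theorem est64 (S : Section8Hyp K A r F I J ε c K' x B H) {q : ℕ} (hq : q ∈ primesQ c x) {h₀ : ℤ}
    (hh₀ : h₀ ∈ H) :
    |∑ p ∈ primesHalf x, wFun c x H S.card B F p ((q : ℤ) - h₀ * p)
        - tauVal H S.card B x I * (uVal r B x I J / r) * ((x : ℝ) / (2 * Real.log x ^ r))|
      ≤ kFive K A / Real.log (Real.log x) ^ 10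
          * (tauVal H S.card B x I * (uVal r B x I J / r) * ((x : ℝ) / (2 * Real.log x ^ r))) := by
  obtain ⟨i₀, hi₀⟩ := tupleEnum_surj H S.card hh₀
  subst hi₀
  obtain ⟨hx32, ht7, htL, hl2L, hr2, hrt, h2r2, h4r2, h12r, hR0, hR4, hxy, -, -, -⟩ := S.regime
  obtain ⟨hl0, hl10, h7l10, hl10t, ht20, hl11L, htA, htK, htK2, htK'⟩ := S.small
  obtain ⟨hqr, hxq, hqy, hqN, hkq, hRq, hqB⟩ := S.primesQ_facts hq
  have hK := S.hK
  have hA := S.hA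
  have hI := S.hI
  have hr1 : 1 ≤ r := le_trans (by norm_num) S.two_le
  have hx0 : (0 : ℝ) < x := by linarith
  have hL0 : 0 < Real.log x := by linarith
  have ht1 : 1 ≤ Real.log x ^ ((1 : ℝ) / 10) := by linarith
  have hq0 : (0 : ℝ) < q := by exact_mod_cast hqr.pos
  have hr0 : (0 : ℝ) < r := by linarith
  have hb1 := one_le_bOverPhi S.hB
  have hb2 := bOverPhi_le_two S.hB
  have hb0 : bOverPhi B ≠ 0 := by linarith
  have h𝔖0 := S.sigmaH_pos
  have hlR1 := S.lR1
  have hlR0 : 0 < Real.log (rLevel x) := by linarith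
  have hlRL : Real.log x ≤ 10 * Real.log (rLevel x) := by
    have := S.lR_lo
    rw [le_div_iff₀ hL0] at this
    linarith
  have hlogr : (1 : ℝ) / 2 ≤ Real.log r := by
    have h2 : Real.log 2 ≤ Real.log r := Real.log_le_log (by norm_num) hr2
    have := Real.log_two_gt_d9
    linarith
  have hJ0 : 0 < J := by
    have h1 : 0 < Real.log r / r * I := by positivity
    exact pos_of_mul_pos_right (lt_of_lt_of_le h1 S.hJ1) hK.le
  have hIJ : I ≤ 2 * K * r * J := by
    have h1 : Real.log r * I ≤ K * J * r := by
      have := S.hJ1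
      rw [div_mul_eq_mul_div, div_le_iff₀ hr0] at this
      linarith
    nlinarith [mul_le_mul_of_nonneg_right hlogr hI.le, h1]
  have hτ0 := S.tau_pos
  have hu0 : 0 < uVal r B x I J := by
    unfold uVal
    have : 0 < bOverPhi B := by linarith
    positivity
  have hT0 : 0 ≤ tauVal H S.card B x I * (uVal r B x I J / r) * ((x : ℝ) / (2 * Real.log x ^ r)) := by
    positivity
  -- the ratio `𝔖_B(L̃_q) = ρ' 𝔖`
  obtain ⟨ρ', hρ'1, hρ'2, hρ'⟩ :=
    singSeriesExcl_wbpForms_ratio S.hH S.card hr1 S.hb hqr hkq hqB S.hB0 i₀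
  have hρ'2' : ρ' ≤ 1 + 2 * r / x := hρ'2.trans (by
    have : 2 * (r : ℝ) / q ≤ 2 * r / x :=
      div_le_div_of_nonneg_left (by positivity) hx0 hxq.le
    linarith)
  have hρ'le2 : ρ' ≤ 2 := by
    have : 2 * (r : ℝ) / x ≤ 1 := by rw [div_le_one hx0]; linarith
    linarith
  -- (7.13) for `L̃_q` at `X = x/2 + 1/4`
  obtain ⟨hadmq, hndq, hcoefq, hcop, hRn⟩ := S.wbpForms_facts hq i₀
  have hX41 : (x : ℝ) / 2 ≤ x / 2 + 1 / 4 := by linarith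
  have hX42 : (x : ℝ) / 2 + 1 / 4 ≤ x * Real.log x ^ 2 := by
    have hL1 : (1 : ℝ) ≤ Real.log x ^ 2 := one_le_pow₀ (by linarith)
    have := le_mul_of_one_le_right hx0.le hL1
    linarith
  obtain ⟨-, -, hB3, -, -⟩ := S.blk _ ((x : ℝ) / 2 + 1 / 4) hadmq hndq hcoefq hX41 hX42
  have h3 := hB3 i₀ hcop hRn
  simp only [formEval_wbpForms_self] at h3
  rw [sum_dyadZ_filter_prime_eq] at h3
  -- identities for the main and secondary terms
  have hP : (primeCountZ (wbpForms (tupleEnum H S.card) q i₀ i₀) ((x : ℝ) / 2 + 1 / 4) : ℝ)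
      = #(primesHalf x) := by
    unfold primeCountZ
    simp only [formEval_wbpForms_self]
    rw [card_dyadZ_filter_prime_eq]
  have htot : ((Nat.totient (wbpForms (tupleEnum H S.card) q i₀ i₀).1.natAbs : ℕ) : ℝ)
      / ((wbpForms (tupleEnum H S.card) q i₀ i₀).1.natAbs : ℝ) = 1 := by
    rw [wbpForms_fst, if_pos rfl]
    simp
  have h𝔖q : singSeriesExcl (wbpForms (tupleEnum H S.card) q i₀) B = ρ' * sigmaH H S.card B := by
    rw [hρ', sigmaH]
  have e1 : bOverPhi B ^ r = bOverPhi B ^ (r - 1) * bOverPhi B := by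
    rw [← pow_succ, Nat.sub_add_cancel hr1]
  have e2 : Real.log x ^ r = Real.log x ^ (r - 1) * Real.log x := by
    rw [← pow_succ, Nat.sub_add_cancel hr1]
  have e3 : Real.log (rLevel x) ^ (r + 1) = Real.log (rLevel x) ^ (r - 1) * Real.log (rLevel x) ^ 2 := by
    rw [← pow_add]
    congr 1
    omega
  have e4 : Real.log (rLevel x) ^ r = Real.log (rLevel x) ^ (r - 1) * Real.log (rLevel x) := by
    rw [← pow_succ, Nat.sub_add_cancel hr1]
  have hL0' : Real.log x ≠ 0 := hL0.ne'
  have hI0 : I ≠ 0 := hI.ne'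
  have hJ0' : J ≠ 0 := hJ0.ne'
  have hr0' : (r : ℝ) ≠ 0 := hr0.ne'
  have hx0' : (x : ℝ) ≠ 0 := hx0.ne'
  have hlR0' : Real.log (rLevel x) ≠ 0 := hlR0.ne'
  have hM : mainTermB (wbpForms (tupleEnum H S.card) q i₀) B ((x : ℝ) / 2 + 1 / 4) (rLevel x) J i₀
      = ρ' * (1 + ((#(primesHalf x) : ℝ) * (2 * Real.log x) / x - 1))
          * (tauVal H S.card B x I * (uVal r B x I J / r) * ((x : ℝ) / (2 * Real.log x ^ r))) := by
    rw [mainTermB, htot, hP, h𝔖q, tauVal, uVal, e1, e2, e3, e4]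
    field_simp
    ring
  have hE : errTermB (wbpForms (tupleEnum H S.card) q i₀) B ((x : ℝ) / 2 + 1 / 4) (rLevel x) I
      = (ρ' * bOverPhi B) * ((#(dyadZ ((x : ℝ) / 2 + 1 / 4)) : ℝ) / x) * (I / J)
          * (2 * Real.log x / Real.log (rLevel x) ^ 2)
          * (tauVal H S.card B x I * (uVal r B x I J / r) * ((x : ℝ) / (2 * Real.log x ^ r))) := by
    rw [errTermB, h𝔖q, tauVal, uVal, e1, e2, e4]
    field_simp
  -- the error parameters
  have hm : |ρ' * (1 + ((#(primesHalf x) : ℝ) * (2 * Real.log x) / x - 1)) - 1|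
      ≤ 2 * (2 * r / x) + A / Real.log x := by
    have hAL1 : A / Real.log x ≤ 1 := by rw [div_le_one hL0]; linarith only [htA, htL, hA]
    exact m64_bound hρ'1 hρ'2' S.pnt_ratio hAL1
  have hd1 : 2 * (2 * (r : ℝ) / x) + A / Real.log x ≤ 1 := by
    have h1 : 2 * (2 * (r : ℝ) / x) ≤ 1 / 3 := by
      rw [show 2 * (2 * (r : ℝ) / x) = 4 * r / x by ring, div_le_div_iff₀ hx0 (by norm_num)]
      linarith
    have h2 : A / Real.log x ≤ 1 / 3 := by
      rw [div_le_div_iff₀ hL0 (by norm_num)]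
      linarith only [htA, htL]
    linarith
  have he : K * ((ρ' * bOverPhi B) * ((#(dyadZ ((x : ℝ) / 2 + 1 / 4)) : ℝ) / x) * (I / J)
      * (2 * Real.log x / Real.log (rLevel x) ^ 2)) ≤ 1600 * K ^ 2 * r / Real.log x := by
    have f1 : ρ' * bOverPhi B ≤ 2 * 2 := mul_le_mul hρ'le2 hb2 (by linarith) (by norm_num)
    have f2 : ((#(dyadZ ((x : ℝ) / 2 + 1 / 4)) : ℝ) / x) ≤ 1 := by
      rw [div_le_one hx0]
      have := (card_dyadZ_bounds (X := (x : ℝ) / 2 + 1 / 4) (by positivity)).2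
      linarith
    have f3 : I / J ≤ 2 * K * r := by rw [div_le_iff₀ hJ0]; linarith
    have f4 : 2 * Real.log x / Real.log (rLevel x) ^ 2 ≤ 200 / Real.log x := by
      rw [div_le_div_iff₀ (by positivity) hL0]
      have := mul_le_mul hlRL hlRL hL0.le (by positivity)
      nlinarith
    have g1 : 0 ≤ ρ' * bOverPhi B := by positivity
    have g2 : 0 ≤ ((#(dyadZ ((x : ℝ) / 2 + 1 / 4)) : ℝ) / x) := by positivity
    have g3 : 0 ≤ I / J := by positivity
    have g4 : 0 ≤ 2 * Real.log x / Real.log (rLevel x) ^ 2 := by positivity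
    calc K * ((ρ' * bOverPhi B) * ((#(dyadZ ((x : ℝ) / 2 + 1 / 4)) : ℝ) / x) * (I / J)
          * (2 * Real.log x / Real.log (rLevel x) ^ 2))
        ≤ K * ((2 * 2) * 1 * (2 * K * r) * (200 / Real.log x)) := by
          apply mul_le_mul_of_nonneg_left _ hK.le
          exact mul_le_mul (mul_le_mul (mul_le_mul f1 f2 g2 (by norm_num)) f3 g3
            (by positivity)) f4 g4 (by positivity)
      _ = 1600 * K ^ 2 * r / Real.log x := by ring
  have hf1 : 1600 * K ^ 2 * r / Real.log x ≤ 1 := by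
    rw [div_le_one hL0]
    have h1 : 1600 * K ^ 2 ≤ Real.log x ^ ((1 : ℝ) / 10) := htK2
    have h2 : (Real.log x ^ ((1 : ℝ) / 10)) ^ 3 ≤ (Real.log x ^ ((1 : ℝ) / 10)) ^ 10 :=
      pow_le_pow_right₀ ht1 (by norm_num)
    have h3 : 1600 * K ^ 2 * (r : ℝ) ≤ Real.log x ^ ((1 : ℝ) / 10) * (Real.log x ^ ((1 : ℝ) / 10)) ^ 2 :=
      mul_le_mul h1 hrt (by positivity) (by positivity)
    have h4 : Real.log x ^ ((1 : ℝ) / 10) * (Real.log x ^ ((1 : ℝ) / 10)) ^ 2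
        = (Real.log x ^ ((1 : ℝ) / 10)) ^ 3 := by ring
    linarith [S.t_pow]
  have hlogX : 0 ≤ Real.log ((x : ℝ) / 2 + 1 / 4) := Real.log_nonneg (by linarith)
  have ha0 : 0 ≤ K / Real.log ((x : ℝ) / 2 + 1 / 4) ^ ((1 : ℝ) / 10) := by positivity
  have ha : K / Real.log ((x : ℝ) / 2 + 1 / 4) ^ ((1 : ℝ) / 10)
      ≤ K * (2 / Real.log x ^ ((1 : ℝ) / 10)) := by
    rw [div_eq_mul_one_div]
    exact mul_le_mul_of_nonneg_left (inv_log_rpow_le hx0 (by linarith) hX41) hK.le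
  have ha1 : K / Real.log ((x : ℝ) / 2 + 1 / 4) ^ ((1 : ℝ) / 10) ≤ 1 := by
    refine ha.trans ?_
    rw [mul_div_assoc', div_le_one (by linarith)]
    linarith only [htK]
  have hg0 : 0 ≤ 12 * (r : ℝ) / x := by positivity
  -- |S' − M| ≤ a M + f T
  have hS' : |∑ p ∈ primesHalf x, sieveWt (wbpForms (tupleEnum H S.card) q i₀) B (rLevel x) F p
        - mainTermB (wbpForms (tupleEnum H S.card) q i₀) B ((x : ℝ) / 2 + 1 / 4) (rLevel x) J i₀|
      ≤ K / Real.log ((x : ℝ) / 2 + 1 / 4) ^ ((1 : ℝ) / 10)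
          * mainTermB (wbpForms (tupleEnum H S.card) q i₀) B ((x : ℝ) / 2 + 1 / 4) (rLevel x) J i₀
        + 1600 * K ^ 2 * r / Real.log x
          * (tauVal H S.card B x I * (uVal r B x I J / r) * ((x : ℝ) / (2 * Real.log x ^ r))) := by
    refine h3.trans (add_le_add le_rfl ?_)
    rw [hE, ← mul_assoc]
    exact mul_le_mul_of_nonneg_right he hT0
  have hmain := abs_sub_le_chain hT0 hM hm hd1 hS' ha0 ha1 hf1 (S.est64_compare hq i₀) hg0
  refine hmain.trans (mul_le_mul_of_nonneg_right ?_ hT0)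
  -- the constant
  have c1 : 5 * (12 * (r : ℝ) / x) + 2 * (2 * r / x) = 64 * r / x := by ring
  have c2 : 64 * (r : ℝ) / x ≤ 64 / Real.log (Real.log x) ^ 10 := by
    rw [div_le_div_iff₀ hx0 (by linarith)]
    have h3 : (r : ℝ) * Real.log (Real.log x) ^ 10
        ≤ (Real.log x ^ ((1 : ℝ) / 10)) ^ 2 * Real.log x ^ ((1 : ℝ) / 10) :=
      mul_le_mul hrt hl10t (by positivity) (by positivity)
    have h4 : (Real.log x ^ ((1 : ℝ) / 10)) ^ 3 ≤ (Real.log x ^ ((1 : ℝ) / 10)) ^ 20 :=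
      pow_le_pow_right₀ ht1 (by norm_num)
    have e5 : (Real.log x ^ ((1 : ℝ) / 10)) ^ 2 * Real.log x ^ ((1 : ℝ) / 10)
        = (Real.log x ^ ((1 : ℝ) / 10)) ^ 3 := by ring
    linarith only [h3, h4, ht20, e5]
  have c3 : 2 * (K / Real.log ((x : ℝ) / 2 + 1 / 4) ^ ((1 : ℝ) / 10))
      ≤ K / Real.log (Real.log x) ^ 10 := by
    have h1 : K * (2 / Real.log x ^ ((1 : ℝ) / 10)) * 2 ≤ K / Real.log (Real.log x) ^ 10 := by
      rw [mul_div_assoc', div_mul_eq_mul_div, div_le_div_iff₀ (by linarith) (by linarith)]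
      have e6 := mul_le_mul_of_nonneg_left h7l10 hK.le
      have e7 := mul_nonneg hK.le (le_trans zero_le_one hl10)
      linarith only [e6, e7]
    have h2 : 2 * (K / Real.log ((x : ℝ) / 2 + 1 / 4) ^ ((1 : ℝ) / 10))
        ≤ K * (2 / Real.log x ^ ((1 : ℝ) / 10)) * 2 := by
      rw [mul_comm (K * _) 2]; exact mul_le_mul_of_nonneg_left ha zero_le_two
    exact h2.trans h1
  have c4 : 1600 * K ^ 2 * r / Real.log x ≤ 1600 * K ^ 2 / Real.log (Real.log x) ^ 10 := by
    rw [div_le_div_iff₀ hL0 (by linarith)]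
    have h3 : (r : ℝ) * Real.log (Real.log x) ^ 10
        ≤ (Real.log x ^ ((1 : ℝ) / 10)) ^ 2 * Real.log x ^ ((1 : ℝ) / 10) :=
      mul_le_mul hrt hl10t (by positivity) (by positivity)
    have h4 : (Real.log x ^ ((1 : ℝ) / 10)) ^ 3 ≤ (Real.log x ^ ((1 : ℝ) / 10)) ^ 10 :=
      pow_le_pow_right₀ ht1 (by norm_num)
    have e5 : (Real.log x ^ ((1 : ℝ) / 10)) ^ 2 * Real.log x ^ ((1 : ℝ) / 10)
        = (Real.log x ^ ((1 : ℝ) / 10)) ^ 3 := by ring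
    have hK2 : 0 ≤ 1600 * K ^ 2 := by positivity
    have := mul_le_mul_of_nonneg_left (show (r : ℝ) * Real.log (Real.log x) ^ 10 ≤ Real.log x by
      linarith only [h3, h4, e5, S.t_pow]) hK2
    linarith only [this]
  have c5 : A / Real.log x ≤ A / Real.log (Real.log x) ^ 10 :=
    div_le_div_of_nonneg_left hA (by linarith) (by linarith)
  have c6 : 64 / Real.log (Real.log x) ^ 10 + K / Real.log (Real.log x) ^ 10
      + 1600 * K ^ 2 / Real.log (Real.log x) ^ 10 + A / Real.log (Real.log x) ^ 10
      ≤ kFive K A / Real.log (Real.log x) ^ 10 := by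
    rw [← add_div, ← add_div, ← add_div]
    apply div_le_div_of_nonneg_right _ (by positivity)
    rw [kFive]
    nlinarith only [hK, hA]
  have c7 : 5 * (12 * (r : ℝ) / x) + 2 * (K / Real.log ((x : ℝ) / 2 + 1 / 4) ^ ((1 : ℝ) / 10))
      + 1600 * K ^ 2 * r / Real.log x + (2 * (2 * r / x) + A / Real.log x)
      = (5 * (12 * (r : ℝ) / x) + 2 * (2 * r / x))
        + 2 * (K / Real.log ((x : ℝ) / 2 + 1 / 4) ^ ((1 : ℝ) / 10))
        + 1600 * K ^ 2 * r / Real.log x + A / Real.log x := by ring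
  rw [c7, c1]
  linarith only [c2, c3, c4, c5, c6]

/-! ### (6.5) -/

/-- `w(p, n) ≤ w_{𝓛_p}(n)`. [cite: FordGreenKonyaginMaynardTao2018, §8 p. 22 (definition of `w`)] -/
theorem w_le_sieveWt (S : Section8Hyp K A r F I J ε c K' x B H) (p : ℕ) (n : ℤ) :
    wFun c x H S.card B F p n ≤ sieveWt (tupleForms (tupleEnum H S.card) p) B (rLevel x) F n := by
  unfold wFun
  split_ifs
  · exact le_rfl
  · exact sieveWt_nonneg _ _ _ _ _

/-- For the translate `𝓛'' = 𝓛_p − (h'p + m)` and `L₀(n) = n − m`: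
`|a₀ b_j − a_j b₀| = |h_j − h'| · p`.
[cite: FordGreenKonyaginMaynardTao2018, §8 p. 24 (proof of (6.5): «L₀ = L − m», Δ_L)] -/
theorem est65_key (S : Section8Hyp K A r F I J ε c K' x B H) (h' : ℤ) (p : ℕ) (m : ℤ)
    (j : Fin r) :
    ((((1 : ℤ), -m) : ℤ × ℤ).1 * (shiftForms (tupleForms (tupleEnum H S.card) p) (h' * (p : ℤ) + m) j).2
        - (shiftForms (tupleForms (tupleEnum H S.card) p) (h' * (p : ℤ) + m) j).1 * (((1 : ℤ), -m) : ℤ × ℤ).2).natAbs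
      = (tupleEnum H S.card j - h').natAbs * p := by
  have e : (((1 : ℤ), -m) : ℤ × ℤ).1 * (shiftForms (tupleForms (tupleEnum H S.card) p) (h' * (p : ℤ) + m) j).2
      - (shiftForms (tupleForms (tupleEnum H S.card) p) (h' * (p : ℤ) + m) j).1 * (((1 : ℤ), -m) : ℤ × ℤ).2 = (tupleEnum H S.card j - h') * p := by
    simp only [shiftForms, tupleForms]
    ring
  rw [e, Int.natAbs_mul, Int.natAbs_natCast]

/-- `Δ_{𝓛''}(L₀)/φ(Δ) ≤ 6 log₂ x` where `Δ = p^r ∏_j |h_j − h'|`.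
[cite: FordGreenKonyaginMaynardTao2018, §8 p. 24 («Δ_L/φ(Δ_L) ≪ log₂ x»)] -/
theorem est65_delta (S : Section8Hyp K A r F I J ε c K' x B H) {h' : ℤ}
    (hh' : |(h' : ℝ)| ≤ K' * ySieve c x / x) (hH' : h' ∉ H) {p : ℕ} (hp : p ∈ primesHalf x)
    (m : ℤ) :
    ((discDelta (shiftForms (tupleForms (tupleEnum H S.card) p) (h' * (p : ℤ) + m)) ((1 : ℤ), -m) : ℕ) : ℝ)
        / (Nat.totient (discDelta (shiftForms (tupleForms (tupleEnum H S.card) p) (h' * (p : ℤ) + m)) ((1 : ℤ), -m)) : ℕ)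
      ≤ 6 * Real.log (Real.log x) := by
  obtain ⟨hx32, ht7, htL, hl2L, hr2, hrt, h2r2, h4r2, h12r, -⟩ := S.regime
  obtain ⟨hl0, hl10, h7l10, hl10t, ht20, hl11L, htA, htK, htK2, htK'⟩ := S.small
  obtain ⟨hpr, hp', hpx', hkp, hRp⟩ := S.primesHalf_facts hp
  have hK' := S.hK'
  have hl7 := S.seven_le
  have hr1 : 1 ≤ r := le_trans (by norm_num) S.two_le
  have hx0 : (0 : ℝ) < x := by linarith
  have hL0 : 0 < Real.log x := by linarith
  set Δ := discDelta (shiftForms (tupleForms (tupleEnum H S.card) p) (h' * (p : ℤ) + m)) ((1 : ℤ), -m) with hΔdef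
  have hne : ∀ j, tupleEnum H S.card j - h' ≠ 0 := fun j =>
    sub_ne_zero.mpr fun h => hH' (h ▸ tupleEnum_mem H S.card j)
  have hΔ : Δ = ∏ j, (tupleEnum H S.card j - h').natAbs * p := by
    rw [hΔdef, discDelta, Finset.prod_congr rfl fun j _ => S.est65_key h' p m j]
    simp
  have hfac_lo : ∀ j, p ≤ (tupleEnum H S.card j - h').natAbs * p := fun j =>
    Nat.le_mul_of_pos_left _ (Int.natAbs_pos.mpr (hne j))
  have hfac_hi : ∀ j, (tupleEnum H S.card j - h').natAbs * p ≤ x * x := by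
    intro j
    have h1 : ((tupleEnum H S.card j - h').natAbs : ℝ) ≤ x := by
      rw [Nat.cast_natAbs, Int.cast_abs, Int.cast_sub]
      have ha := S.abs_h_le j
      have hy : K' * ySieve c x / x ≤ K' * Real.log x := by
        rw [div_le_iff₀ hx0]
        have := mul_le_mul_of_nonneg_left S.y_le hK'.le
        linarith
      have hL1 : (1 : ℝ) ≤ Real.log x := by linarith
      have h3 : (1 + K') * Real.log x ≤ Real.log x ^ ((1 : ℝ) / 10) * Real.log x :=
        mul_le_mul_of_nonneg_right (by linarith) hL0.le
      have h4 : Real.log x ^ ((1 : ℝ) / 10) * Real.log x ≤ Real.log x * Real.log x :=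
        mul_le_mul_of_nonneg_right htL hL0.le
      have h5 : Real.log x * Real.log x ≤ x := by rw [← sq]; exact S.L2_le_x
      calc |((tupleEnum H S.card j : ℤ) : ℝ) - h'|
          ≤ |((tupleEnum H S.card j : ℤ) : ℝ)| + |(h' : ℝ)| := abs_sub _ _
        _ ≤ 2 * (r : ℝ) ^ 2 + K' * Real.log x := add_le_add ha (hh'.trans hy)
        _ ≤ x := by nlinarith
    have h2 : ((tupleEnum H S.card j - h').natAbs : ℝ) * p ≤ x * x :=
      mul_le_mul h1 hpx' (by positivity) hx0.le
    exact_mod_cast h2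
  have hΔlo : p ≤ Δ := by
    rw [hΔ]
    calc p ≤ p ^ r := Nat.le_self_pow (by omega) p
      _ = p ^ #(Finset.univ : Finset (Fin r)) := by simp
      _ ≤ ∏ j, (tupleEnum H S.card j - h').natAbs * p :=
          Finset.pow_card_le_prod _ _ _ fun j _ => hfac_lo j
  have hΔhi : Δ ≤ (x * x) ^ r := by
    rw [hΔ]
    calc ∏ j, (tupleEnum H S.card j - h').natAbs * p
        ≤ (x * x) ^ #(Finset.univ : Finset (Fin r)) :=
          Finset.prod_le_pow_card _ _ _ fun j _ => hfac_hi j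
      _ = (x * x) ^ r := by simp
  have hxΔ : x ≤ 2 * Δ := by
    have : x < 2 * p := by exact_mod_cast hp'
    omega
  have htot := S.tot Δ hxΔ
  have hΔ1 : (1 : ℝ) < Δ := by
    have := hpr.two_le
    have : (2 : ℝ) ≤ Δ := by exact_mod_cast this.trans hΔlo
    linarith
  have hΔR : (Δ : ℝ) ≤ ((x : ℝ) * x) ^ r := by exact_mod_cast hΔhi
  have hlogΔ : Real.log Δ ≤ r * (2 * Real.log x) := by
    have := Real.log_le_log (by linarith) hΔR
    rw [Real.log_pow, Real.log_mul hx0.ne' hx0.ne'] at this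
    linarith
  have hlogΔ0 : 0 < Real.log Δ := Real.log_pos hΔ1
  have hlogt : Real.log (Real.log x ^ ((1 : ℝ) / 10)) = (1 : ℝ) / 10 * Real.log (Real.log x) :=
    Real.log_rpow hL0 _
  have hll : Real.log (Real.log Δ) ≤ 2 * Real.log (Real.log x) := by
    have h1 : Real.log Δ ≤ (Real.log x ^ ((1 : ℝ) / 10)) ^ 2 * (2 * Real.log x) :=
      hlogΔ.trans (mul_le_mul_of_nonneg_right hrt (by positivity))
    have h2 := Real.log_le_log hlogΔ0 h1
    rw [Real.log_mul (by positivity) (by positivity), Real.log_pow,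
      Real.log_mul two_ne_zero hL0.ne', hlogt] at h2
    have := Real.log_two_lt_d9
    push_cast at h2
    linarith
  calc (Δ : ℝ) / Nat.totient Δ ≤ 3 * Real.log (Real.log Δ) := htot
    _ ≤ 6 * Real.log (Real.log x) := by linarith

/-- `0 ≤ E_B(𝓛_p − c₀; X) ≤ (B/φB)^r · 2𝔖 · y · (log R)^{r−1} I_r` for `X + 1 ≤ y`.
[cite: FordGreenKonyaginMaynardTao2018, §8 p. 24 (secondary term of (7.14) in the proof of (6.5))] -/
theorem est65_err (S : Section8Hyp K A r F I J ε c K' x B H) {p : ℕ} (hp : p ∈ primesHalf x)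
    (c₀ : ℤ) {X : ℝ} (hX0 : 0 ≤ X) (hXy : X + 1 ≤ ySieve c x) :
    0 ≤ errTermB (shiftForms (tupleForms (tupleEnum H S.card) p) c₀) B X (rLevel x) I ∧
    errTermB (shiftForms (tupleForms (tupleEnum H S.card) p) c₀) B X (rLevel x) I
      ≤ bOverPhi B ^ r * (2 * sigmaH H S.card B) * ySieve c x * Real.log (rLevel x) ^ (r - 1) * I := by
  obtain ⟨hx32, -, -, -, hr2, -⟩ := S.regime
  obtain ⟨hpr, hp', hpx', hkp, hRp⟩ := S.primesHalf_facts hp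
  have hr1 : 1 ≤ r := le_trans (by norm_num) S.two_le
  have hI := S.hI
  have hb1 := one_le_bOverPhi S.hB
  have hb0 : 0 < bOverPhi B := by linarith
  have h𝔖0 : 0 < singSeriesExcl (tupleForms (tupleEnum H S.card) 1) B := S.sigmaH_pos
  have hlR0 : 0 < Real.log (rLevel x) := by linarith [S.lR1]
  have hp0 : (0 : ℝ) < p := by exact_mod_cast hpr.pos
  obtain ⟨ρ, hρ1, hρ2, hρ⟩ := singSeriesExcl_tupleForms_ratio S.hH S.card hr1 S.hb hpr hkp S.hB0
  have hρle : ρ ≤ 2 := by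
    have : 2 * (r : ℝ) / p ≤ 1 := by
      rw [div_le_one hp0]
      have h1 : (2 * r ^ 2 : ℝ) < p := by exact_mod_cast hkp
      have h2 : (r : ℝ) ≤ r ^ 2 := by nlinarith
      linarith
    linarith
  have h𝔖le : singSeriesExcl (tupleForms (tupleEnum H S.card) p) B ≤ 2 * sigmaH H S.card B := by
    rw [hρ, sigmaH]
    exact mul_le_mul_of_nonneg_right hρle h𝔖0.le
  have h𝔖p0 : 0 ≤ singSeriesExcl (tupleForms (tupleEnum H S.card) p) B := by
    rw [hρ]; positivity
  have hD : (#(dyadZ X) : ℝ) ≤ ySieve c x := (card_dyadZ_bounds hX0).2.trans hXy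
  have hσ0 : 0 ≤ 2 * sigmaH H S.card B := by have := S.sigmaH_pos; positivity
  rw [errTermB, singSeriesExcl_shiftForms]
  refine ⟨by positivity, ?_⟩
  refine mul_le_mul_of_nonneg_right (mul_le_mul_of_nonneg_right ?_ (by positivity)) hI.le
  exact mul_le_mul (mul_le_mul_of_nonneg_left h𝔖le (by positivity)) hD (by positivity)
    (by positivity)

set_option maxHeartbeats 2000000 in
/-- **(6.5), inner sum**: for `p ∈ 𝒫` and `h' ∉ H` with `|h'| ≤ K' y/x`,
`∑_{q ∈ 𝒬} w(p, q − h'p) ≤ ∑_{X < n ≤ 2X, n − m prime} w_{𝓛''}(n) ≪ K log₂ x · (B/φB)^r 𝔖 y (log R)^{r−1} I_r`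
via (7.14) for the translate `𝓛'' = 𝓛_p − h'p − m`, `m = ⌊y⌋ − 2x`, `X = ⌊y⌋ − x`, `L₀ = L − m`.
[cite: FordGreenKonyaginMaynardTao2018, §8 p. 24 (proof of (6.5))] -/
theorem est65_inner (S : Section8Hyp K A r F I J ε c K' x B H) {h' : ℤ}
    (hh' : |(h' : ℝ)| ≤ K' * ySieve c x / x) (hH' : h' ∉ H) {p : ℕ} (hp : p ∈ primesHalf x)
    {N : ℕ} (hN : ⌊ySieve c x⌋₊ = N) :
    ∑ q ∈ primesQ c x, wFun c x H S.card B F p ((q : ℤ) - h' * p)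
      ≤ K * (6 * Real.log (Real.log x))
        * (bOverPhi B ^ r * (2 * sigmaH H S.card B) * ySieve c x
            * Real.log (rLevel x) ^ (r - 1) * I) := by
  obtain ⟨hx32, ht7, htL, hl2L, hr2, hrt, h2r2, h4r2, h12r, hR0, hR4, hxy, hyN1, hNy, h2xN⟩ :=
    S.regime
  obtain ⟨hl0, hl10, h7l10, hl10t, ht20, hl11L, htA, htK, htK2, htK'⟩ := S.small
  obtain ⟨hpr, hp', hpx', hkp, hRp⟩ := S.primesHalf_facts hp
  rw [hN] at hyN1 hNy h2xN
  have hK := S.hK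
  have hK' := S.hK'
  have hI := S.hI
  have hr1 : 1 ≤ r := le_trans (by norm_num) S.two_le
  have hx0 : (0 : ℝ) < x := by linarith
  have hL0 : 0 < Real.log x := by linarith
  have hL1 : 1 ≤ Real.log x := by linarith
  have hpx : p ≤ x := le_of_mem_primesHalf hp
  have h2xN' : 2 * (x : ℝ) ≤ N := by exact_mod_cast h2xN
  have hX50 : (0 : ℝ) ≤ (N : ℝ) - x := by linarith
  have hX51 : (1 : ℝ) ≤ (N : ℝ) - x := by linarith
  have hxL : (x : ℝ) ≤ x * Real.log x := le_mul_of_one_le_right hx0.le hL1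
  set m : ℤ := (N : ℤ) - 2 * (x : ℤ) with hm
  have hmR : ((m : ℤ) : ℝ) = (N : ℝ) - 2 * x := by rw [hm]; push_cast; ring
  -- Step 1: `w ≤ w_{𝓛_p}` and translation
  have h1 : ∑ q ∈ primesQ c x, wFun c x H S.card B F p ((q : ℤ) - h' * p)
      ≤ ∑ q ∈ primesQ c x, sieveWt (shiftForms (tupleForms (tupleEnum H S.card) p) (h' * (p : ℤ) + m)) B (rLevel x) F ((q : ℤ) + m) := by
    refine Finset.sum_le_sum fun q _ => ?_
    refine (S.w_le_sieveWt p _).trans (le_of_eq ?_)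
    rw [show (q : ℤ) + m = ((q : ℤ) - h' * p) + (h' * (p : ℤ) + m) by ring]
    exact (sieveWt_shiftForms _ _ _ _ _ _).symm
  -- Step 2: reindex
  have h2 : ∑ q ∈ primesQ c x, sieveWt (shiftForms (tupleForms (tupleEnum H S.card) p) (h' * (p : ℤ) + m)) B (rLevel x) F ((q : ℤ) + m)
      = ∑ n ∈ (primesQ c x).image (fun q : ℕ => (q : ℤ) + m),
          sieveWt (shiftForms (tupleForms (tupleEnum H S.card) p) (h' * (p : ℤ) + m)) B (rLevel x) F n := by
    rw [Finset.sum_image]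
    intro a _ b _ hab
    have hab' : (a : ℤ) + m = (b : ℤ) + m := hab
    exact_mod_cast add_right_cancel hab'
  -- Step 3: the image lies in the set of (7.14)
  have h3 : (primesQ c x).image (fun q : ℕ => (q : ℤ) + m) ⊆
      (dyadZ ((N : ℝ) - x)).filter (fun n => 0 < formEval ((1 : ℤ), -m) n ∧
        (formEval ((1 : ℤ), -m) n).natAbs.Prime ∧
        ((N : ℝ) - x) ^ ((1 : ℝ) / 30) < (formEval ((1 : ℤ), -m) n : ℝ)) := by
    intro n hn
    rw [Finset.mem_image] at hn
    obtain ⟨q, hq, rfl⟩ := hn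
    obtain ⟨hqr, hxq, hqy, hqN, -, -, -⟩ := S.primesQ_facts hq
    rw [hN] at hqN
    have hqN' : (q : ℝ) ≤ N := by exact_mod_cast hqN
    have hfe : formEval ((1 : ℤ), -m) ((q : ℤ) + m) = q := by simp only [formEval]; ring
    rw [Finset.mem_filter, hfe, mem_dyadZ, Int.natAbs_natCast]
    refine ⟨⟨?_, ?_⟩, by exact_mod_cast hqr.pos, hqr, ?_⟩
    · push_cast
      rw [hmR]
      linarith
    · push_cast
      rw [hmR]
      linarith
    · push_cast
      have hXx2 : (N : ℝ) - x ≤ (x : ℝ) ^ (2 : ℝ) := by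
        rw [Real.rpow_two]
        have : Real.log x ≤ x := by nlinarith [S.L2_le_x]
        nlinarith [S.y_le]
      calc ((N : ℝ) - x) ^ ((1 : ℝ) / 30) ≤ ((x : ℝ) ^ (2 : ℝ)) ^ ((1 : ℝ) / 30) :=
            Real.rpow_le_rpow hX50 hXx2 (by norm_num)
        _ = (x : ℝ) ^ ((1 : ℝ) / 15) := by rw [← Real.rpow_mul hx0.le]; norm_num
        _ ≤ (x : ℝ) ^ (1 : ℝ) := Real.rpow_le_rpow_of_exponent_le (by linarith) (by norm_num)
        _ = x := Real.rpow_one _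
        _ < q := hxq
  -- Step 4: (7.14) for `𝓛''` on `(X, 2X]`, `X = N − x`
  have hadm'' : FormsAdmissible (shiftForms (tupleForms (tupleEnum H S.card) p) (h' * (p : ℤ) + m)) :=
    (formsAdmissible_shiftForms _ _).mpr
      (formsAdmissible_tupleForms (tupleEnum H S.card) S.hadm (Or.inr hpr))
  have hy0 : 0 < ySieve c x := by linarith
  have hc0 : |(((h' * (p : ℤ) + m : ℤ)) : ℝ)| ≤ (Real.log x - 1) * (x * Real.log x) := by
    push_cast
    rw [hmR]
    have e1 : |(h' : ℝ) * p| ≤ K' * (x * Real.log x) := by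
      rw [abs_mul, Nat.abs_cast]
      have h5 : |(h' : ℝ)| * p ≤ (K' * ySieve c x / x) * x :=
        mul_le_mul hh' hpx' (by positivity) (by positivity)
      rw [div_mul_cancel₀ _ hx0.ne'] at h5
      exact h5.trans (mul_le_mul_of_nonneg_left S.y_le hK'.le)
    have e2 : |((N : ℝ) - 2 * x)| ≤ x * Real.log x := by
      rw [abs_le]
      constructor <;> linarith [S.y_le]
    have e3 : (K' + 1) * (x * Real.log x) ≤ (Real.log x - 1) * (x * Real.log x) :=
      mul_le_mul_of_nonneg_right (by linarith) (by positivity)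
    calc |(h' : ℝ) * p + ((N : ℝ) - 2 * x)| ≤ |(h' : ℝ) * p| + |((N : ℝ) - 2 * x)| :=
        abs_add_le _ _
      _ ≤ K' * (x * Real.log x) + x * Real.log x := add_le_add e1 e2
      _ = (K' + 1) * (x * Real.log x) := by ring
      _ ≤ (Real.log x - 1) * (x * Real.log x) := e3
  have hcoef := S.coef_shift hpx hc0
  have hX1 : (x : ℝ) / 2 ≤ (N : ℝ) - x := by linarith
  have hX2 : (N : ℝ) - x ≤ x * Real.log x ^ 2 := by
    have : x * Real.log x ≤ x * Real.log x ^ 2 := by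
      rw [sq, ← mul_assoc]; exact le_mul_of_one_le_right (by positivity) hL1
    linarith [S.y_le]
  obtain ⟨-, -, -, hB4, -⟩ := S.blk _ ((N : ℝ) - x) hadm''
    ((formsNondegenerate_shiftForms _ _).mpr
      (formsNondegenerate_tupleForms _ (tupleEnum_injective H S.card) hpr.ne_zero))
    hcoef hX1 hX2
  have hl1 : |(((((1 : ℤ), -m) : ℤ × ℤ).1 : ℤ) : ℝ)| ≤ ((N : ℝ) - x) ^ 2 := by
    simp only [Int.cast_one, abs_one]
    nlinarith
  have hl2 : |(((((1 : ℤ), -m) : ℤ × ℤ).2 : ℤ) : ℝ)| ≤ ((N : ℝ) - x) ^ 2 := by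
    simp only [Int.cast_neg, abs_neg]
    rw [hmR, abs_of_nonneg (by linarith)]
    nlinarith
  have hne : ∀ j, tupleEnum H S.card j - h' ≠ 0 := fun j =>
    sub_ne_zero.mpr fun h => hH' (h ▸ tupleEnum_mem H S.card j)
  have hnp : ∀ j, (((1 : ℤ), -m) : ℤ × ℤ).1 * (shiftForms (tupleForms (tupleEnum H S.card) p) (h' * (p : ℤ) + m) j).2
      - (shiftForms (tupleForms (tupleEnum H S.card) p) (h' * (p : ℤ) + m) j).1 * (((1 : ℤ), -m) : ℤ × ℤ).2 ≠ 0 := fun j =>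
    Int.natAbs_ne_zero.mp (by
      rw [S.est65_key h' p m j]
      exact Nat.mul_ne_zero (Int.natAbs_ne_zero.mpr (hne j)) hpr.ne_zero)
  have h4 := hB4 ((1 : ℤ), -m) one_ne_zero hl1 hl2 hnp
  have h5 : ∑ n ∈ (primesQ c x).image (fun q : ℕ => (q : ℤ) + m), sieveWt (shiftForms (tupleForms (tupleEnum H S.card) p) (h' * (p : ℤ) + m)) B (rLevel x) F n
      ≤ ∑ n ∈ (dyadZ ((N : ℝ) - x)).filter (fun n => 0 < formEval ((1 : ℤ), -m) n ∧
          (formEval ((1 : ℤ), -m) n).natAbs.Prime ∧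
          ((N : ℝ) - x) ^ ((1 : ℝ) / 30) < (formEval ((1 : ℤ), -m) n : ℝ)),
          sieveWt (shiftForms (tupleForms (tupleEnum H S.card) p) (h' * (p : ℤ) + m)) B (rLevel x) F n :=
    Finset.sum_le_sum_of_subset_of_nonneg h3 fun n _ _ => sieveWt_nonneg _ _ _ _ _
  have hΔ := S.est65_delta hh' hH' hp m
  have hXy : (N : ℝ) - x + 1 ≤ ySieve c x := by
    have : (1 : ℝ) ≤ x := by linarith
    linarith
  obtain ⟨hE0, hE⟩ := S.est65_err hp (h' * (p : ℤ) + m) hX50 hXy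
  have hΔ0 : 0 ≤ ((discDelta (shiftForms (tupleForms (tupleEnum H S.card) p) (h' * (p : ℤ) + m)) ((1 : ℤ), -m) : ℕ) : ℝ)
      / (Nat.totient (discDelta (shiftForms (tupleForms (tupleEnum H S.card) p) (h' * (p : ℤ) + m)) ((1 : ℤ), -m)) : ℕ) := by positivity
  calc ∑ q ∈ primesQ c x, wFun c x H S.card B F p ((q : ℤ) - h' * p)
      ≤ _ := h1
    _ = _ := h2
    _ ≤ _ := h5
    _ ≤ _ := h4
    _ ≤ K * (6 * Real.log (Real.log x))
        * (bOverPhi B ^ r * (2 * sigmaH H S.card B) * ySieve c x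
            * Real.log (rLevel x) ^ (r - 1) * I) :=
        mul_le_mul (mul_le_mul_of_nonneg_left hΔ hK.le) hE hE0 (by positivity)

set_option maxHeartbeats 2000000 in
/-- **(6.5)**: for `h' ∉ H` with `|h'| ≤ K' y/x`,
`∑_{q ∈ 𝒬} ∑_{p ∈ 𝒫} w(p, q − h'p) ≪ (1/log₂^{10} x) · τ (x/log^r x)(y/log x)`.
[cite: FordGreenKonyaginMaynardTao2018, (6.5), §8 p. 24] -/
theorem est65 (S : Section8Hyp K A r F I J ε c K' x B H) {h' : ℤ}
    (hh' : |(h' : ℝ)| ≤ K' * ySieve c x / x) (hH' : h' ∉ H) :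
    ∑ q ∈ primesQ c x, ∑ p ∈ primesHalf x, wFun c x H S.card B F p ((q : ℤ) - h' * p)
      ≤ kFive K A / Real.log (Real.log x) ^ 10
        * (tauVal H S.card B x I * ((x : ℝ) / Real.log x ^ r) * (ySieve c x / Real.log x)) := by
  obtain ⟨hx32, ht7, htL, hl2L, hr2, hrt, h2r2, h4r2, h12r, hR0, hR4, hxy, -, -, -⟩ := S.regime
  obtain ⟨hl0, hl10, h7l10, hl10t, ht20, hl11L, htA, htK, htK2, htK'⟩ := S.small
  obtain ⟨N, hN⟩ : ∃ N : ℕ, ⌊ySieve c x⌋₊ = N := ⟨_, rfl⟩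
  have hK := S.hK
  have hA := S.hA
  have hI := S.hI
  have hr1 : 1 ≤ r := le_trans (by norm_num) S.two_le
  have hx0 : (0 : ℝ) < x := by linarith
  have hL0 : 0 < Real.log x := by linarith
  have hlR1 := S.lR1
  have hlR0 : 0 < Real.log (rLevel x) := by linarith
  have hlRL : Real.log x ≤ 10 * Real.log (rLevel x) := by
    have := S.lR_lo
    rw [le_div_iff₀ hL0] at this
    linarith
  have hb1 := one_le_bOverPhi S.hB
  have hb0 : 0 < bOverPhi B := by linarith
  have h𝔖0 := S.sigmaH_pos
  have hy0 : 0 < ySieve c x := by linarith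
  have hτ0 := S.tau_pos
  rw [Finset.sum_comm]
  set C₀ := K * (6 * Real.log (Real.log x))
        * (bOverPhi B ^ r * (2 * sigmaH H S.card B) * ySieve c x
            * Real.log (rLevel x) ^ (r - 1) * I) with hC₀
  have hC₀0 : 0 ≤ C₀ := by positivity
  have h1 : ∑ p ∈ primesHalf x, ∑ q ∈ primesQ c x, wFun c x H S.card B F p ((q : ℤ) - h' * p)
      ≤ #(primesHalf x) * C₀ := by
    refine (Finset.sum_le_sum fun p hp => S.est65_inner hh' hH' hp hN).trans (le_of_eq ?_)
    rw [Finset.sum_const, nsmul_eq_mul]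
  have hP : (#(primesHalf x) : ℝ) ≤ x / Real.log x := by
    have h := (abs_le.mp S.pnt).2
    have hAL1 : A / Real.log x ≤ 1 := by rw [div_le_one hL0]; linarith only [htA, htL, hA]
    have h2 : A / Real.log x * (x / (2 * Real.log x)) ≤ 1 * (x / (2 * Real.log x)) :=
      mul_le_mul_of_nonneg_right hAL1 (by positivity)
    have e : (x : ℝ) / Real.log x = 2 * (x / (2 * Real.log x)) := by
      field_simp
    rw [e]
    linarith
  have h2 : (#(primesHalf x) : ℝ) * C₀ ≤ x / Real.log x * C₀ := mul_le_mul_of_nonneg_right hP hC₀0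
  have e4 : Real.log (rLevel x) ^ r = Real.log (rLevel x) ^ (r - 1) * Real.log (rLevel x) := by
    rw [← pow_succ, Nat.sub_add_cancel hr1]
  have hL0' : Real.log x ≠ 0 := hL0.ne'
  have hlR0' : Real.log (rLevel x) ≠ 0 := hlR0.ne'
  have hx0' : (x : ℝ) ≠ 0 := hx0.ne'
  have hid : (x : ℝ) / Real.log x * C₀ = 6 * K * Real.log (Real.log x) / Real.log (rLevel x)
      * (tauVal H S.card B x I * ((x : ℝ) / Real.log x ^ r) * (ySieve c x / Real.log x)) := by
    rw [hC₀, tauVal, e4]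
    field_simp
  have hT0 : 0 ≤ tauVal H S.card B x I * ((x : ℝ) / Real.log x ^ r) * (ySieve c x / Real.log x) := by
    positivity
  have c1 : 6 * K * Real.log (Real.log x) / Real.log (rLevel x)
      ≤ 60 * K / Real.log (Real.log x) ^ 10 := by
    rw [div_le_div_iff₀ hlR0 (by positivity)]
    have := mul_le_mul_of_nonneg_left (hl11L.trans hlRL) (by positivity : (0 : ℝ) ≤ 6 * K)
    have e : 6 * K * Real.log (Real.log x) * Real.log (Real.log x) ^ 10
        = 6 * K * (Real.log (Real.log x) * Real.log (Real.log x) ^ 10) := by ring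
    rw [e]
    linarith
  have c2 : 60 * K / Real.log (Real.log x) ^ 10 ≤ kFive K A / Real.log (Real.log x) ^ 10 :=
    div_le_div_of_nonneg_right (by rw [kFive]; nlinarith [hK, hA]) (by positivity)
  calc ∑ p ∈ primesHalf x, ∑ q ∈ primesQ c x, wFun c x H S.card B F p ((q : ℤ) - h' * p)
      ≤ #(primesHalf x) * C₀ := h1
    _ ≤ x / Real.log x * C₀ := h2
    _ = _ := hid
    _ ≤ _ := mul_le_mul_of_nonneg_right (c1.trans c2) hT0

end Section8Hyp

end Literature.NumberTheory.Sieve.FGKMT2018
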